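import Summits.PneNP.PneNP.Theses.PhaseTwins
import Literature.Computability.Complexity.PCPProofs
import Literature.Computability.Complexity.RandomizedProofs
import Literature.Computability.Complexity.Transducers
import Literature.Computability.Complexity.PairProjections
import Literature.Computability.Complexity.TimeBoundsProofs
import Literature.Computability.Complexity.HardcoreInapproximability
import Literature.Computability.Complexity.KarpCliqueGadget

set_option linter.dupNamespace false

/-!
# Disproof attempts for crux `PseudorandomTwinsAbove` (stmt-PneNP-2721, route PneNP/PhaseTwins)

Standing adversary file (cdisprove seat `refuter-cdisprove-stmt-PneNP-2721-0`). Prose lives in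
docstrings; everything below is kernel-checked unless marked `sorry` (near-misses only).

## Findings (cycle 1, 2026-08-16)

* **No kill.** The crux is an `∃`-statement (∃ Δ p q, ∃ samplable D₀ D₁, PPT-indistinguishable,
  hard-core counts separated by a factor 8 a.a.s.). A refutation is a *universal* PPT
  distinguisher for every such pair. Informally the typed (index-free) crux follows from EITHER
  uniformly-secure one-way functions (PRG image vs uniform through a PCP-gap MAX-CUT reduction and
  the GŠV16 phase gadgets) OR `NP ⊄ P/poly` (tiny-instance brute-force sampler, status map below),
  so `¬ crux` would refute both beliefs at once. Not refutable in substance; degenerate parameter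
  choices only help the prover (see `sideConditions_satisfiable`).
* **Load-bearing hypothesis = the time bound on the tests** (`A.IsPolyTime id encodeBool`).
  `pseudorandomTwinsAbove_false_without_polyTime`: with the time bound dropped (tests = all
  `RandAlg (List Bool) Bool`, still INDEX-FREE, i.e. the test never sees `n`) the statement is
  FALSE. Mechanism (`no_setwise_indistinguishable_far_pair`, a gliding-hump / Schur-property
  argument): clause (ii) makes `D₀ n`, `D₁ n` concentrate on disjoint events, and then ONE fixed
  set `S ⊆ {0,1}*` already has `|D₀(n_k)(S) − D₁(n_k)(S)| ≥ 3/8` along a subsequence. So the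
  index-free weakening of clause (i) flagged by route reviewers is NOT an information-theoretic
  loophole: all the content of the crux is computational.
* **Index-aware repair, same verdict** (`pseudorandomTwinsAboveIndexed_false_without_polyTime`):
  the reviewers' repair of clause (i) (`A.pr id (boolPair (unaryEncodeNat n) x) {true}`) is also
  false once the time bound is dropped — the witness set `S` ignores the index.
* **The positivity conjunct `0 < N x` is the junk-excluder**
  (`pseudorandomTwinsAboveWithoutPositivity_holds`): drop it and `D₀ = D₁ = δ_{[0,1,1]}` (a
  non-decoding string, `decode_junk`; constant samplers are PPT, `isPolySamplable_pure`) with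
  `t = 0` proves the statement. Any real witness must put `D₁` on valid bounded-degree codes.
* **Natural strengthening refuted**: statistically close twins (`tv_lower_bound`): the
  statistical distance of `D₀ n`, `D₁ n` tends to `1` under (ii), for ANY ensembles.
* **coinLen is free advice** (`isPolyTime_coinLen_irrelevant`): `RandAlg.IsPolyTime` constrains
  `coinLen` only by a polynomial bound, so the test class of clause (i) is PPT with `O(log |x|)`
  bits of non-uniform advice (the value `coinLen |x|`). Consequence recorded for provers: a
  sampler cannot diagonalise against the tests (fooling one bit-selector machine for all coin
  lengths `ℓ ≤ |x|` forces equal samples), so the tiny-instance loophole of index-free tests does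
  not make the crux cheaply PROVABLE either.
* **Samplability is load-bearing for non-triviality** (`exists_close_pair_of_card_lt`, the
  pigeonhole kernel): against any FINITE family of `[0,1]`-valued tests, any chain of
  `(g+1)^{#tests} + 1` inputs contains a `1/g`-indistinguishable pair; along a chain with
  `N(x_{j+1}) ≥ 8 N(x_j)` this gives factor-8 twins. With non-samplable point-mass ensembles and an
  enumeration of the countably many PPT tests this proves the crux minus `IsPolySamplable`
  (diagonalisation; not formalised beyond the kernel lemma — enumerating TM2 machines is not in
  the tree). This is Goldreich, *Foundations of Cryptography I* (CUP 2004 printing), §3.2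
  Exercise 10 Part 2 with its guideline (supports of size `t+1` via convex hulls, then "a
  standard diagonalization argument"; held copy PDF pp. 211–212) = Goldreich–Meyer,
  *Computational indistinguishability: algorithms vs. circuits*, TCS 191 (1998) 215–218
  (bibliography item [111], PDF p. 431): ensembles indistinguishable by all PPT ALGORITHMS yet far
  apart exist unconditionally — but they are not samplable.

## Findings (cycle 2, 2026-08-16, seat `refuter-cdisprove-stmt-PneNP-2721-g2-0`)

* **Still no kill.** The sandwich `NP ⊄ P/poly ⇒ typed crux ⇒ X ⇒ P ≠ NP` (status map (1) below +
  glue 2723 WITH the coin-length advice, re-derived independently by the r1 ideators (B5, card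
  length-advice-horizon §UPWARD) and confirmed by all three r1 triagers) means `¬ crux` would place
  an NP-hard gap-counting problem in `P/poly`-type territory: not landable. Cycle 2 therefore adds
  kernel-checked NECESSARY CONDITIONS on witnesses, all obtained from CHEAP members of the typed
  test class (section "Cycle 2" at the end of this file; landed/pending as
  `Negative/RegularTests.lean` + `Negative/EscapeAndJunk.lean` + `Negative/VertexEscape.lean` +
  `Negative/SetwiseToTV.lean`).
* **The typed test class contains every regular test** (`polyTimeComputable_dfa`,
  `isPolyTime_ofDet_dfa`: a DFA is a finite-state transducer, `FST.polyTimeComputable_eval`),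
  **every finite-set indicator** (`exists_dfa_of_finite`, Myhill–Nerode) and **every length-set
  test `[|x| ∈ T]` for ARBITRARY `T ⊆ ℕ`** (`isPolyTime_coinFlag`, `pr_coinFlag`: coin budget
  `coinLen := 1_T`, the machine only reports whether it received a coin — the advice loophole of
  `isPolyTime_coinLen_irrelevant` turned into an explicit test).
* **Clause (i) alone** forces `D₀ n`, `D₁ n` to give asymptotically equal mass to every regular
  language, finite set and length set (`dfa_merge`, `finite_merge`, `lengthSet_merge`).
  **Refuted variant**: twins at different lengths do not exist — if the lengths of `D₀ n` live on
  `T₀ n` and those of `D₁ n` on `T₁ n` with `T₀ n ∩ T₁ n = ∅` (e.g. YES codes of length `ℓ₀ n`, NO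
  codes of length `ℓ₁ n ≠ ℓ₀ n`, ANY functions), clause (i) fails
  (`no_twins_on_disjoint_lengthSets`, `no_twins_at_distinct_lengths`; gliding hump on `ℕ`). Design
  constraint for the lines: L2/L3 need a SHAPE-UNIFORM Karp chain (code length a function of the
  seed length only) on both sides; L1's min-max pair sits on one common length by construction.
* **Clauses (i)+(ii)**: every finite set, in particular `{x : |x| ≤ L}`, is negligible for BOTH
  ensembles (`finset_mass_tendsto_zero`, `shortStrings_mass_tendsto_zero`) — the length-escape
  lemma behind glue 2723, kernel-checked in abstract form (any disjoint `U n`, `V n`).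
* **Junk inside the promise** (`hardcoreCount_junk`): `N(1 0 w) = 1` for EVERY `w` — such strings
  unpair to `([], [])` and decode to the empty graph on `Fin 0`. So the NO-event `{0 < N ≤ t n}`
  contains the cylinder `10{0,1}*` once `t n ≥ 1`: cycle 1's "positivity forces `D₁` onto valid
  codes" must be read as "positivity excludes the `N = 0` junk only"; what keeps `D₁` off the
  `N = 1` cylinder is indistinguishability from `D₀` (`junk_mass_tendsto_zero`, a 4-state DFA
  test). Consequently `t n ≥ 1` eventually, and (informal corollary: `01v` with `v ≠ []` has
  `N = 0`, strings of length `≤ 2` are finitely many) any `D₁` is `1 − o(1)` on strings starting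
  with a doubled bit `00`/`11`, like every valid code with `≥ 1` vertex.
* **Setwise merging is TV merging** (`setwise_merge_uniform`, Phillips' lemma / Schur property,
  gliding hump): if `|P n S − Q n S| → 0` for every `S` then `sup_S |P n S − Q n S| → 0`. Hence
  (`tv_merge_of_unbounded_tests`) clause (i) WITHOUT the time bound is exactly statistical
  indistinguishability `TV(D₀ n, D₁ n) → 0` — the index-free unbounded test class loses nothing
  against the index-fed one, and cycle 1's `no_setwise_indistinguishable_far_pair` is the special
  case of disjointly concentrated pairs; and for the TYPED crux the LENGTH LAWS of every witness
  merge in total variation (`lengthLaws_tv_merge`): asymptotically the YES and NO sides have the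
  same length law.
* **Vertex counts and thresholds escape** (`vertexCount_escapes`, `threshold_tendsto_atTop`,
  `witness_constraints`): for EVERY witness of the crux and every `M`, the event "the sample
  decodes to a graph on `≤ M` vertices" is negligible for BOTH ensembles, and `t n → ∞` (a valid
  code on `m ≥ 1` vertices has `N ≥ m` since `p, q ≥ 1` by the guard, `guard_pos`; few-vertex codes
  form a finite set, `fewVertexCodes_finite`; `0`-vertex codes are junk-or-tiny,
  `zeroVertexCodes_subset`). So the tiny-instance loophole of the index-free clause (i) is real
  but narrow: instances may be `(log n)^{o(1)}`-sized, yet their size and the threshold must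
  diverge, on both sides, with merging length laws.
* **Why it still resists** (sharpened): without a complexity hypothesis the refuter's arsenal
  INSIDE the typed class is regular tests + arbitrary length advice + finitely many exceptions (this
  file) and generic PPT simulations; every candidate line fools all of these by construction (L1:
  min-max pairs fool all small circuits, DFAs included; L2/L3/L4: one public deterministic
  shape-uniform map applied to a pseudorandom seed, so regular and length statistics of the two
  sides agree up to the seed's indistinguishability). A kill needs a distinguisher for an NP-hard
  gap problem on samplable instances, i.e. `¬X`.

## Findings (cycle 3, 2026-08-16, seat `refuter-cdisprove-stmt-PneNP-2721-g3-0`) — TARGETS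

* **Still no kill of the crux**, and none expected while `OWFExist` stands: the lead
  (`prover-line-stmt-PneNP-2721-0`) PICKED line `prg-image-exact-threshold-lift`
  (`Lines/prg-image-exact-threshold-lift.lean`): `OWFExist → PseudorandomTwinsAbove` through
  HILL, PRG-image source twins, the tree's PCP gap machine, a shape uniformiser, Karp's conflict
  graph and an FGLSS-style counting window at `(Δ, p, q) = (B+3, 2^K, 1)`. Its six stubs are this
  cycle's `-- Targets` (section "Cycle 3" at the end of the file). NOTE for planners: the line
  proves the INDEX-FED, NEGLIGIBLE-advantage form of clause (i) first (`IsCompIndistinguishable`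
  of the push-forwards) and only then forgets the index (S5) — so the reviewers' index-aware
  repair of the crux costs this line nothing; only the tiny-instance/min-max line needs the typed
  (index-free) reading.
* **Target audit (all six stubs SURVIVE the cheap arsenal; agrees with drefute r1,
  `DrefuteR1Reshaped.md`)**: S1 `stub_prgImageTwins` — LANDED by the lead (p76829,
  `Summit.PneNP.PneNP.Theorems.stub_prgImageTwins`); S2a `stub_gapE3SATB` — true in print
  (PCP + occurrence reduction; the MAX 3SAT-5 gap with perfect completeness of Feige, JACM 45
  (1998), doi:10.1145/285055.285059, §2.1 — section number from memory, `lit` services degraded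
  this session), `val [] = 1` keeps `[]` off the NO side; S2b `stub_dupPad` — the
  corner `φ = []` is disarmed exactly by the tree's junk convention `CNF.maxSatFraction_nil = 1`
  (hypothesis `val φ ≤ 1 - γ` then forces `γ ≤ 0`, `maxSatFraction_nil_le_iff`), and `max B 1`
  is NECESSARY
  (`not_dupPadWithPlainBound`, kernel-checked); S4a `stub_conflictGraphFn` — pure FP plumbing;
  S4b `stub_conflictGraphGap` — true BECAUSE `IsExactWidth 3` demands three pairwise DISTINCT
  variables per clause: with repeated variables allowed the counting window is FALSE
  (`not_conflictGraphGapWithoutNodup`, kernel-checked: `(x∨x∨x) ∧ (¬x∨¬x∨¬x)` has `val = 1/2` but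
  conflict graph `K₃,₃`, against `2K₃` for two disjoint positive clauses; `8·N(no) > N(yes)` for
  every `(Δ, p, q)`); its occurrence hypothesis is load-bearing too
  (`not_conflictGraphGapWithoutOccurrenceBound`, kernel-checked: `x₀` occurring `8Δ` times puts
  the YES code off the promise, `N = 0`, `τ = 0`), while `0 < φ.length` is removable (`τ 0 := 0`,
  `hardcoreCount_conflictGraph_nil`);
  S5 `stub_clauseI` — true, and its `StrictMono ℓ'` / fixed-length hypotheses are unnecessary
  (simulate the index-free test on sparse windows of padded lengths, one good index per window;
  i.o. simulation suffices for the `o(1)` conclusion — drefute r1's observation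
  `DrefuteR1StubClauseI.md`, re-derived).
* **Why the crux still resists (unchanged)**: `NP ⊄ P/poly ⇒ typed crux ⇒ X ⇒ P ≠ NP`; the
  refuter's unconditional arsenal inside the typed test class is exhausted by cycles 1–2's
  necessary conditions, all of which the picked line meets by construction (one common length per
  `n`, positivity from `I = ∅`, DFA/length statistics inherited from the PRG, thresholds
  `t n = 2^{K m(ℓ n) - 3} → ∞`, vertex counts `3 m(ℓ n) → ∞`).

## Why it resists — status map (informal, for provers/planners; corrected 2026-08-16)

Two readings of clause (i) must be kept apart.

1. AS TYPED (index-free tests, `o(1)` advantage). A refutation is a universal PPT(+`O(log)`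
   advice) distinguisher for EVERY pair of samplable `N`-separated ensembles. Sketch why none can
   be exhibited: assume `NP ⊄ P/poly`. By PCP + GŠV16 (randomness of the gadget fixed as advice,
   thresholds made length-uniform by padding with components of known `Z`) the promise problem
   `gap-#IS_{Δ,λ}` ("`N ≥ 8t(s)` vs `0 < N ≤ t(s)`" on `s`-bit codes) has, for every `k`, infinitely
   many lengths `s` without circuits of size `s^k`. A SAMPLER running in time `poly(n)` on `1ⁿ` can
   then brute-force, on instance lengths `s' ≤ s(n) = (log n)^{o(1)}`, (a) the largest exponent
   `k(n) → ∞` and length `s'(n) → ∞` at which no size-`s'^{k(n)+c}` circuit separates the two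
   promise sets, and (b) by LP-duality/min-max plus Chernoff sparsification, a canonical pair of
   multisets `X_n ⊆ {N ≥ 8t}`, `Y_n ⊆ {0 < N ≤ t}` of power-of-two size that `1/s'`-fool every
   size-`s'^{k(n)}` circuit; it outputs a uniform element of `X_n` (resp. `Y_n`). Every fixed PPT
   test with coin-length advice is, on length-`s'` inputs, an average of size-`poly(s')` circuits,
   so its advantage tends to `0`; clause (ii) holds with probability `1`. Hence, informally,
   `NP ⊄ P/poly ⇒ crux as typed`, and `¬ crux` would put `NP`-hard gap counting into `P/poly`
   infinitely-often-everywhere — not something a refuter can land. (This is the "degenerate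
   small-instance witnesses from an a.e. non-uniform hardness hypothesis" remark of retriage g3,
   sharpened: i.o. hardness at every polynomial size suffices because the sampler can search for a
   hard length.) Consequently the typed crux is NOT of one-way-function strength and does not imply
   `OWFExist`; its consequence `X` goes only through glue 2723 (coin-length advice trick).
2. INDEX-FED REPAIR (`A.pr id (boolPair (unaryEncodeNat n) x) {true}`, reviewers' FixProbe). Now a
   `poly(n)`-time test recomputes the sampler's tiny canonical twins and separates them, so the
   witnesses of (1) die; uniformly-secure `OWF ⇒ PRG ⇒` (PRG image vs uniform through a PCP-gap
   MAX-CUT reduction and the GŠV16 phase gadgets) `⇒ crux'`, and `crux'` with negligible advantage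
   `⇒ OWFExist` (Goldreich FoC I §3.8 Ex. 11 = tree fact
   `Goldreich2001_owfExist_of_indistinguishable_far`, p49807). OWF-strength both ways.

BARRIERS (catalogue `Literature/Barriers/PneNP/`). `NPHardnessToOneWayFunctions` (AGGM06 Thm. 4;
Bogdanov–Trevisan: non-adaptive worst-to-average-case reductions for NP w.r.t. samplable ensembles
give `coNP ⊆ AM/poly`) bites reading (2): crux' cannot be based on GŠV16 NP-hardness by such
reductions. Reading (1) slips under it only through the tiny-instance loophole (the sampler is
polynomial in `n` but EXPONENTIAL in the instance size, outside the BT setting), which is also why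
reading (1) is not the statement the route intends. `Relativization`/`NaturalProofs`: not engaged
by the negative lemmas here (pure measure theory / counting).

LANDED (tree, importable): `Summits/PneNP/PneNP/Theorems/PseudorandomTwinsAbove/Negative/`
`FalseWithoutPolyTime.lean` (p72935), `TestClassKernels.lean` (p73091),
`IndexedAndPositivity.lean` (p74071) — namespace
`Summit.PneNP.PneNP.Theorems.PseudorandomTwinsAbove.Negative`. Cycle 2 (same namespace; all ACCEPTED: p75931, p76683, p76702, p77007):
`RegularTests.lean` (p75931: DFA / finite-set / length-set tests, merging, no twins on disjoint
length sets), `EscapeAndJunk.lean` (p76683: finite sets escape, junk cylinder),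
`VertexEscape.lean` (p77007: vertex counts and thresholds escape, `witness_constraints`),
`SetwiseToTV.lean` (p76702: Phillips' lemma, TV merging of length laws).
Cycle 3 (seat -g3-0): `TargetsTight.lean` (p80704, review-queued: `not_conflictGraphGapWithoutNodup`,
`not_dupPadWithPlainBound`, corners, conflict-graph counting lemmas) and `TargetsOccurrence.lean`
(p81918, review-queued: `not_conflictGraphGapWithoutOccurrenceBound`) —
the section "Cycle 3" below is their union (with `occConflictGraph` = `conflictGraph`).

Either way nothing is refutable; the kernel-checked content of this file is what survives:
the time bound on the tests is load-bearing in BOTH readings, positivity is the junk-excluder,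
and samplability + an infinite uniform test family are needed for non-triviality.
-/

namespace Summit.PneNP.PneNP.Cruxes.PseudorandomTwinsAbove.Disproof

open Literature.Computability.Complexity Literature.Computability.MetaComplexity
open Filter Topology
open scoped ENNReal

noncomputable section

/-! ## Side conditions on `(Δ, p, q)` are satisfiable (no arithmetic vacuity) -/

/-- `Δ = 3`, `λ = 5 > λ_c(3) = 2² / 1³ = 4`: the arithmetic guard of the crux is satisfiable, so
nothing can be refuted (or proved) from the guard alone. [folklore] -/
theorem sideConditions_satisfiable :
    ∃ Δ p q : ℕ, 3 ≤ Δ ∧ 0 < q ∧ ((Δ : ℝ) - 1) ^ (Δ - 1) / ((Δ : ℝ) - 2) ^ Δ < (p : ℝ) / q :=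
  ⟨3, 5, 1, le_rfl, Nat.one_pos, by norm_num⟩

/-! ## Real-valued masses of sets under a `PMF` -/

variable {X : Type*}

/-- `mass p S = p(S)` as a real number (the crux's `Ensemble.prob` is `mass (D n)`). [folklore] -/
def mass (p : PMF X) (S : Set X) : ℝ := (p.toOuterMeasure S).toReal

/-- `p(S) + p(Sᶜ) = 1` in `ℝ≥0∞`. [folklore] -/
theorem toOuterMeasure_add_compl' (p : PMF X) (s : Set X) :
    p.toOuterMeasure s + p.toOuterMeasure sᶜ = 1 := by
  rw [PMF.toOuterMeasure_apply, PMF.toOuterMeasure_apply, ← ENNReal.tsum_add, ← p.tsum_coe]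
  refine tsum_congr fun x => ?_
  by_cases hx : x ∈ s
  · rw [Set.indicator_of_mem hx, Set.indicator_of_notMem (show x ∉ sᶜ from fun h => h hx),
      add_zero]
  · rw [Set.indicator_of_notMem hx, Set.indicator_of_mem (show x ∈ sᶜ from hx), zero_add]

/-- `p(S) ≤ 1`. [folklore] -/
theorem toOuterMeasure_le_one' (p : PMF X) (s : Set X) : p.toOuterMeasure s ≤ 1 :=
  le_of_le_of_eq le_self_add (toOuterMeasure_add_compl' p s)

/-- `p(S) ≠ ∞`. [folklore] -/
theorem toOuterMeasure_ne_top' (p : PMF X) (s : Set X) : p.toOuterMeasure s ≠ ∞ :=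
  ((toOuterMeasure_le_one' p s).trans_lt ENNReal.one_lt_top).ne

/-- `0 ≤ mass p S`. [folklore] -/
theorem mass_nonneg (p : PMF X) (S : Set X) : 0 ≤ mass p S := ENNReal.toReal_nonneg

/-- `mass p S ≤ 1`. [folklore] -/
theorem mass_le_one (p : PMF X) (S : Set X) : mass p S ≤ 1 := by
  have h := ENNReal.toReal_mono ENNReal.one_ne_top (toOuterMeasure_le_one' p S)
  simpa [mass] using h

/-- Monotonicity. [folklore] -/
theorem mass_mono (p : PMF X) {S T : Set X} (h : S ⊆ T) : mass p S ≤ mass p T :=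
  ENNReal.toReal_mono (toOuterMeasure_ne_top' p T) (p.toOuterMeasure.mono h)

/-- Binary subadditivity. [folklore] -/
theorem mass_union_le (p : PMF X) (S T : Set X) : mass p (S ∪ T) ≤ mass p S + mass p T := by
  unfold mass
  rw [← ENNReal.toReal_add (toOuterMeasure_ne_top' p S) (toOuterMeasure_ne_top' p T)]
  exact ENNReal.toReal_mono
    (ENNReal.add_ne_top.2 ⟨toOuterMeasure_ne_top' p S, toOuterMeasure_ne_top' p T⟩)
    (MeasureTheory.measure_union_le S T)

/-- Complements. [folklore] -/
theorem mass_add_compl (p : PMF X) (S : Set X) : mass p S + mass p Sᶜ = 1 := by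
  unfold mass
  rw [← ENNReal.toReal_add (toOuterMeasure_ne_top' p S) (toOuterMeasure_ne_top' p Sᶜ),
    toOuterMeasure_add_compl', ENNReal.toReal_one]

/-- Mass of a finite set. [folklore] -/
theorem mass_finset (p : PMF X) (E : Finset X) : mass p ↑E = ∑ x ∈ E, (p x).toReal := by
  unfold mass
  rw [PMF.toOuterMeasure_apply_finset, ENNReal.toReal_sum (fun x _ => PMF.apply_ne_top p x)]

/-- Mass of a singleton. [folklore] -/
theorem mass_singleton (p : PMF X) (x : X) : mass p {x} = (p x).toReal := by
  unfold mass
  rw [PMF.toOuterMeasure_apply_singleton]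

/-- Tightness of a single `PMF`: a finite set carries all but `δ` of the mass. [folklore] -/
theorem exists_finset_mass_compl_le (p : PMF X) {δ : ℝ} (hδ : 0 < δ) :
    ∃ E : Finset X, mass p (↑E)ᶜ ≤ δ := by
  have hsum : ∑' x, p x ≠ ∞ := by rw [p.tsum_coe]; exact ENNReal.one_ne_top
  have h := ENNReal.tendsto_tsum_compl_atTop_zero hsum
  have hδ' : (0 : ℝ≥0∞) < ENNReal.ofReal δ := by simpa using hδ
  obtain ⟨E, hE⟩ := (h.eventually (ge_mem_nhds hδ')).exists
  refine ⟨E, ?_⟩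
  have hcompl : p.toOuterMeasure (↑E)ᶜ = ∑' b : {x // x ∉ E}, p b := by
    rw [PMF.toOuterMeasure_apply, ← tsum_subtype]
    rfl
  unfold mass
  rw [hcompl]
  exact (ENNReal.toReal_mono ENNReal.ofReal_ne_top hE).trans_eq (ENNReal.toReal_ofReal hδ.le)

/-- KEY ESTIMATE. If `U ∩ V = ∅`, a finite set `Φ` has `p`-mass at most
`Σ_{x∈Φ} |p(x) − q(x)| + (1 − q(V)) + (1 − p(U))`: split `Φ` along `U`; the part inside `U` is
compared pointwise with `q`, which gives `U ⊆ Vᶜ` little mass; the part outside `U` has little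
`p`-mass. [folklore] -/
theorem mass_finset_le_of_disjoint (p q : PMF X) {U V : Set X} (hUV : Disjoint U V)
    (Φ : Finset X) :
    mass p ↑Φ ≤ (∑ x ∈ Φ, |mass p {x} - mass q {x}|) + (1 - mass q V) + (1 - mass p U) := by
  classical
  simp only [mass_singleton]
  set Φ₁ := Φ.filter (fun x => x ∈ U) with hΦ₁
  set Φ₂ := Φ.filter (fun x => x ∉ U) with hΦ₂
  have hsplit : (↑Φ : Set X) ⊆ ↑Φ₁ ∪ ↑Φ₂ := by
    intro x hx
    have hx' : x ∈ Φ := Finset.mem_coe.1 hx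
    by_cases hU : x ∈ U
    · exact Or.inl (Finset.mem_coe.2 (Finset.mem_filter.2 ⟨hx', hU⟩))
    · exact Or.inr (Finset.mem_coe.2 (Finset.mem_filter.2 ⟨hx', hU⟩))
  have h1 : mass p ↑Φ₁ ≤ (∑ x ∈ Φ, |(p x).toReal - (q x).toReal|) + (1 - mass q V) := by
    have hq : mass q ↑Φ₁ ≤ 1 - mass q V := by
      have hsub : (↑Φ₁ : Set X) ⊆ Vᶜ := by
        intro x hx hxV
        have hxU : x ∈ U := (Finset.mem_filter.1 (Finset.mem_coe.1 hx)).2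
        exact Set.disjoint_left.1 hUV hxU hxV
      have h' := mass_mono q hsub
      have hc := mass_add_compl q V
      linarith
    rw [mass_finset] at hq ⊢
    calc ∑ x ∈ Φ₁, (p x).toReal
        ≤ ∑ x ∈ Φ₁, ((q x).toReal + |(p x).toReal - (q x).toReal|) := by
          refine Finset.sum_le_sum fun x _ => ?_
          have := le_abs_self ((p x).toReal - (q x).toReal)
          linarith
      _ = ∑ x ∈ Φ₁, (q x).toReal + ∑ x ∈ Φ₁, |(p x).toReal - (q x).toReal| :=
          Finset.sum_add_distrib
      _ ≤ (1 - mass q V) + ∑ x ∈ Φ, |(p x).toReal - (q x).toReal| := by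
          have hle : ∑ x ∈ Φ₁, |(p x).toReal - (q x).toReal|
              ≤ ∑ x ∈ Φ, |(p x).toReal - (q x).toReal| :=
            Finset.sum_le_sum_of_subset_of_nonneg (Finset.filter_subset _ _)
              (fun _ _ _ => abs_nonneg _)
          linarith
      _ = _ := by ring
  have h2 : mass p ↑Φ₂ ≤ 1 - mass p U := by
    have hsub : (↑Φ₂ : Set X) ⊆ Uᶜ := by
      intro x hx
      exact (Finset.mem_filter.1 (Finset.mem_coe.1 hx)).2
    have h' := mass_mono p hsub
    have hc := mass_add_compl p U
    linarith
  calc mass p ↑Φ ≤ mass p (↑Φ₁ ∪ ↑Φ₂) := mass_mono p hsplit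
    _ ≤ mass p ↑Φ₁ + mass p ↑Φ₂ := mass_union_le p _ _
    _ ≤ _ := by linarith

/-! ## The gliding hump: no pair of ensembles is setwise indistinguishable and far apart -/

/-- MAIN NEGATIVE LEMMA (abstract form). Let `P n`, `Q n` be probability mass functions and
`U n ∩ V n = ∅` with `P n (U n) → 1`, `Q n (V n) → 1` (this is clause (ii) of the crux). Then
it is impossible that EVERY fixed set `S` (an index-free, computationally unbounded test) has
`|P n (S) − Q n (S)| → 0`. Proof: assuming it, every finite set has vanishing `P n`- and
`Q n`-mass (key estimate), and a gliding-hump recursion `n₁ < n₂ < ⋯` with finite humps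
`F_k ⊆ U (n_k)` builds one set `S = ⋃ F_k` with `P (n_k) S ≥ 11/16`, `Q (n_k) S ≤ 5/16`
for all `k`. (This is the Schur property of `ℓ¹` specialised to differences of probability
vectors with asymptotically disjoint supports.) [folklore] -/
theorem no_setwise_indistinguishable_far_pair (P Q : ℕ → PMF X) (U V : ℕ → Set X)
    (hUV : ∀ n, Disjoint (U n) (V n))
    (hP : Tendsto (fun n => mass (P n) (U n)) atTop (𝓝 1))
    (hQ : Tendsto (fun n => mass (Q n) (V n)) atTop (𝓝 1))
    (h : ∀ S : Set X, Tendsto (fun n => |mass (P n) S - mass (Q n) S|) atTop (𝓝 0)) :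
    False := by
  classical
  -- pointwise discrepancy on a finite set
  set d : ℕ → Finset X → ℝ := fun n Φ => ∑ x ∈ Φ, |mass (P n) {x} - mass (Q n) {x}| with hd
  have hd_tendsto : ∀ Φ : Finset X, Tendsto (fun n => d n Φ) atTop (𝓝 0) := by
    intro Φ
    have h' := tendsto_finsetSum Φ (fun x (_ : x ∈ Φ) => h {x})
    simpa [hd] using h'
  -- good indices exist beyond any bound
  have hstep : ∀ (m : ℕ) (Φ : Finset X), ∃ n, m < n ∧ d n Φ ≤ 1 / 16 ∧
      15 / 16 ≤ mass (P n) (U n) ∧ 15 / 16 ≤ mass (Q n) (V n) := by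
    intro m Φ
    have e1 := (hd_tendsto Φ).eventually_lt_const (show (0 : ℝ) < 1 / 16 by norm_num)
    have e2 := hP.eventually_const_lt (show (15 / 16 : ℝ) < 1 by norm_num)
    have e3 := hQ.eventually_const_lt (show (15 / 16 : ℝ) < 1 by norm_num)
    obtain ⟨n, hn⟩ := ((eventually_gt_atTop m).and (e1.and (e2.and e3))).exists
    exact ⟨n, hn.1, hn.2.1.le, hn.2.2.1.le, hn.2.2.2.le⟩
  -- two-sided tightness at every index
  have htight : ∀ n, ∃ E : Finset X, mass (P n) (↑E)ᶜ ≤ 1 / 16 ∧ mass (Q n) (↑E)ᶜ ≤ 1 / 16 := by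
    intro n
    obtain ⟨E₁, h₁⟩ := exists_finset_mass_compl_le (P n) (show (0 : ℝ) < 1 / 16 by norm_num)
    obtain ⟨E₂, h₂⟩ := exists_finset_mass_compl_le (Q n) (show (0 : ℝ) < 1 / 16 by norm_num)
    refine ⟨E₁ ∪ E₂, ?_, ?_⟩
    · refine (mass_mono _ (Set.compl_subset_compl.2 ?_)).trans h₁
      rw [Finset.coe_union]; exact Set.subset_union_left
    · refine (mass_mono _ (Set.compl_subset_compl.2 ?_)).trans h₂
      rw [Finset.coe_union]; exact Set.subset_union_right
  -- the recursion: state = (last index, union of all finite sets used so far)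
  let nOf : ℕ × Finset X → ℕ := fun s => Classical.choose (hstep s.1 s.2)
  have nOf_spec : ∀ s : ℕ × Finset X, s.1 < nOf s ∧ d (nOf s) s.2 ≤ 1 / 16 ∧
      15 / 16 ≤ mass (P (nOf s)) (U (nOf s)) ∧ 15 / 16 ≤ mass (Q (nOf s)) (V (nOf s)) :=
    fun s => Classical.choose_spec (hstep s.1 s.2)
  let EOf : ℕ × Finset X → Finset X := fun s => Classical.choose (htight (nOf s))
  have EOf_spec : ∀ s : ℕ × Finset X,
      mass (P (nOf s)) (↑(EOf s))ᶜ ≤ 1 / 16 ∧ mass (Q (nOf s)) (↑(EOf s))ᶜ ≤ 1 / 16 :=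
    fun s => Classical.choose_spec (htight (nOf s))
  let st : ℕ → ℕ × Finset X := fun k => Nat.rec (0, ∅) (fun _ s => (nOf s, s.2 ∪ EOf s)) k
  have st_succ : ∀ k, st (k + 1) = (nOf (st k), (st k).2 ∪ EOf (st k)) := fun k => rfl
  let nk : ℕ → ℕ := fun k => nOf (st k)
  let Φk : ℕ → Finset X := fun k => (st k).2
  let Ek : ℕ → Finset X := fun k => EOf (st k)
  let Fk : ℕ → Finset X := fun k => ((Ek k).filter (fun x => x ∈ U (nk k))) \ Φk k
  have Φ_succ : ∀ k, Φk (k + 1) = Φk k ∪ Ek k := fun k => rfl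
  have nk_strictMono : StrictMono nk := by
    refine strictMono_nat_of_lt_succ fun k => ?_
    have h' := (nOf_spec (st (k + 1))).1
    exact h'
  have Φ_mono : Monotone Φk :=
    monotone_nat_of_le_succ fun k => by rw [Φ_succ]; exact Finset.subset_union_left
  have E_sub_Φ : ∀ {j k : ℕ}, j < k → Ek j ⊆ Φk k := by
    intro j k hjk
    have h1 : Ek j ⊆ Φk (j + 1) := by rw [Φ_succ]; exact Finset.subset_union_right
    exact h1.trans (Φ_mono (Nat.succ_le_of_lt hjk))
  have F_sub_E : ∀ k, Fk k ⊆ Ek k := fun k => Finset.sdiff_subset.trans (Finset.filter_subset _ _)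
  have F_sub_U : ∀ k, (↑(Fk k) : Set X) ⊆ U (nk k) := by
    intro k x hx
    have hx' := Finset.mem_sdiff.1 (Finset.mem_coe.1 hx)
    exact (Finset.mem_filter.1 hx'.1).2
  have F_disj_Φ : ∀ k, Disjoint (Fk k) (Φk k) := fun k => Finset.sdiff_disjoint
  -- the single test set
  let S : Set X := ⋃ k, (↑(Fk k) : Set X)
  have S_sub : ∀ k, S ⊆ (↑(Fk k) ∪ ↑(Φk k)) ∪ (↑(Ek k))ᶜ := by
    intro k x hx
    obtain ⟨j, hj⟩ := Set.mem_iUnion.1 hx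
    rcases lt_trichotomy j k with hjk | rfl | hkj
    · exact Or.inl (Or.inr (Finset.mem_coe.2 (E_sub_Φ hjk (F_sub_E j (Finset.mem_coe.1 hj)))))
    · exact Or.inl (Or.inl hj)
    · refine Or.inr fun hxE => ?_
      have hxΦ : x ∈ Φk j := E_sub_Φ hkj (Finset.mem_coe.1 hxE)
      exact Finset.disjoint_left.1 (F_disj_Φ j) (Finset.mem_coe.1 hj) hxΦ
  have F_sub_S : ∀ k, (↑(Fk k) : Set X) ⊆ S := fun k =>
    Set.subset_iUnion (fun k => (↑(Fk k) : Set X)) k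
  have U_sub : ∀ k, U (nk k) ⊆ (↑(Fk k) ∪ (↑(Ek k))ᶜ) ∪ ↑(Φk k) := by
    intro k x hxU
    by_cases hxE : x ∈ Ek k
    · by_cases hxΦ : x ∈ Φk k
      · exact Or.inr (Finset.mem_coe.2 hxΦ)
      · exact Or.inl (Or.inl (Finset.mem_coe.2
          (Finset.mem_sdiff.2 ⟨Finset.mem_filter.2 ⟨hxE, hxU⟩, hxΦ⟩)))
    · exact Or.inl (Or.inr fun h' => hxE (Finset.mem_coe.1 h'))
  -- the discrepancy on S is bounded below at every stage
  have hgap : ∀ k, 3 / 8 ≤ |mass (P (nk k)) S - mass (Q (nk k)) S| := by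
    intro k
    have hspec := nOf_spec (st k)
    have hE := EOf_spec (st k)
    have hdΦ : d (nk k) (Φk k) ≤ 1 / 16 := hspec.2.1
    have hPU : 15 / 16 ≤ mass (P (nk k)) (U (nk k)) := hspec.2.2.1
    have hQV : 15 / 16 ≤ mass (Q (nk k)) (V (nk k)) := hspec.2.2.2
    have hPE : mass (P (nk k)) (↑(Ek k))ᶜ ≤ 1 / 16 := hE.1
    have hQE : mass (Q (nk k)) (↑(Ek k))ᶜ ≤ 1 / 16 := hE.2
    have hPΦ : mass (P (nk k)) ↑(Φk k) ≤ 3 / 16 := by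
      have h' := mass_finset_le_of_disjoint (P (nk k)) (Q (nk k)) (hUV (nk k)) (Φk k)
      have hd' : ∑ x ∈ Φk k, |mass (P (nk k)) {x} - mass (Q (nk k)) {x}| = d (nk k) (Φk k) :=
        rfl
      linarith
    have hQΦ : mass (Q (nk k)) ↑(Φk k) ≤ 3 / 16 := by
      have h' := mass_finset_le_of_disjoint (Q (nk k)) (P (nk k)) (hUV (nk k)).symm (Φk k)
      have hd' : ∑ x ∈ Φk k, |mass (Q (nk k)) {x} - mass (P (nk k)) {x}| = d (nk k) (Φk k) := by
        simp only [hd]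
        exact Finset.sum_congr rfl fun x _ => abs_sub_comm _ _
      linarith
    have hPS : 11 / 16 ≤ mass (P (nk k)) S := by
      have h1 : mass (P (nk k)) (U (nk k)) ≤ mass (P (nk k)) ↑(Fk k) +
          mass (P (nk k)) (↑(Ek k))ᶜ + mass (P (nk k)) ↑(Φk k) := by
        calc mass (P (nk k)) (U (nk k))
            ≤ mass (P (nk k)) ((↑(Fk k) ∪ (↑(Ek k))ᶜ) ∪ ↑(Φk k)) := mass_mono _ (U_sub k)
          _ ≤ mass (P (nk k)) (↑(Fk k) ∪ (↑(Ek k))ᶜ) + mass (P (nk k)) ↑(Φk k) :=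
              mass_union_le _ _ _
          _ ≤ _ := by
              have h'' := mass_union_le (P (nk k)) ↑(Fk k) (↑(Ek k))ᶜ
              linarith
      have h2 : mass (P (nk k)) ↑(Fk k) ≤ mass (P (nk k)) S := mass_mono _ (F_sub_S k)
      linarith
    have hQS : mass (Q (nk k)) S ≤ 5 / 16 := by
      have h1 : mass (Q (nk k)) S ≤ mass (Q (nk k)) ↑(Fk k) + mass (Q (nk k)) ↑(Φk k) +
          mass (Q (nk k)) (↑(Ek k))ᶜ := by
        calc mass (Q (nk k)) S
            ≤ mass (Q (nk k)) ((↑(Fk k) ∪ ↑(Φk k)) ∪ (↑(Ek k))ᶜ) := mass_mono _ (S_sub k)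
          _ ≤ mass (Q (nk k)) (↑(Fk k) ∪ ↑(Φk k)) + mass (Q (nk k)) (↑(Ek k))ᶜ :=
              mass_union_le _ _ _
          _ ≤ _ := by
              have h'' := mass_union_le (Q (nk k)) ↑(Fk k) ↑(Φk k)
              linarith
      have h2 : mass (Q (nk k)) ↑(Fk k) ≤ 1 - mass (Q (nk k)) (V (nk k)) := by
        have hsub : (↑(Fk k) : Set X) ⊆ (V (nk k))ᶜ := fun x hx hxV =>
          Set.disjoint_left.1 (hUV (nk k)) (F_sub_U k hx) hxV
        have h' := mass_mono (Q (nk k)) hsub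
        have hc := mass_add_compl (Q (nk k)) (V (nk k))
        linarith
      linarith
    rw [le_abs]
    exact Or.inl (by linarith)
  -- contradiction with the hypothesis on the test S along the subsequence nk
  have hlim : Tendsto (fun k => |mass (P (nk k)) S - mass (Q (nk k)) S|) atTop (𝓝 0) :=
    (h S).comp nk_strictMono.tendsto_atTop
  obtain ⟨k, hk⟩ := (hlim.eventually_lt_const (show (0 : ℝ) < 3 / 8 by norm_num)).exists
  exact absurd (hgap k) (not_le.2 hk)

/-- Corollary used for the "statistically close" strengthening: under clause (ii) the
statistical distance is eventually large — already the single moving event `U n` has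
`P n (U n) − Q n (U n) ≥ P n (U n) + Q n (V n) − 1 → 1`. So the natural strengthening of the crux
to statistically indistinguishable twins is false for every pair of ensembles. [folklore] -/
theorem tv_lower_bound (p q : PMF X) {U V : Set X} (hUV : Disjoint U V) :
    mass p U + mass q V - 1 ≤ mass p U - mass q U := by
  have hsub : U ⊆ Vᶜ := fun x hxU hxV => Set.disjoint_left.1 hUV hxU hxV
  have h' := mass_mono q hsub
  have hc := mass_add_compl q V
  linarith

/-- The strengthening "some event sequence separates while the SAME event sequence is
indistinguishable" is contradictory: with `P n (U n) → 1`, `Q n (V n) → 1`, `U n ∩ V n = ∅`,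
the gap on `U n` tends to `1`, not `0`. [folklore] -/
theorem not_indistinguishable_on_separating_events (P Q : ℕ → PMF X) (U V : ℕ → Set X)
    (hUV : ∀ n, Disjoint (U n) (V n))
    (hP : Tendsto (fun n => mass (P n) (U n)) atTop (𝓝 1))
    (hQ : Tendsto (fun n => mass (Q n) (V n)) atTop (𝓝 1))
    (h : Tendsto (fun n => mass (P n) (U n) - mass (Q n) (U n)) atTop (𝓝 0)) : False := by
  have e1 := h.eventually_lt_const (show (0 : ℝ) < 1 / 2 by norm_num)
  have e2 := hP.eventually_const_lt (show (3 / 4 : ℝ) < 1 by norm_num)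
  have e3 := hQ.eventually_const_lt (show (3 / 4 : ℝ) < 1 by norm_num)
  obtain ⟨n, hn1, hn2, hn3⟩ := (e1.and (e2.and e3)).exists
  have h' := tv_lower_bound (P n) (Q n) (hUV n)
  linarith

/-! ## From `RandAlg` tests to sets: deterministic indicator tests -/

/-- The acceptance functional of the deterministic indicator test of `S` against a `PMF` is the
mass of `S`: `Σ' x, D(x) · Pr[1_S(x) = true] = D(S)`. [folklore] -/
theorem tsum_indicatorTest_eq_mass (D : PMF (List Bool)) (S : Set (List Bool))
    [DecidablePred (· ∈ S)] :
    ∑' x, (D x).toReal * (RandAlg.ofDet fun x => decide (x ∈ S)).pr id x {b | b = true}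
      = mass D S := by
  classical
  have hpr : ∀ x, (RandAlg.ofDet fun x => decide (x ∈ S)).pr id x {b | b = true}
      = if x ∈ S then 1 else 0 := by
    intro x
    rw [RandAlg.pr_ofDet]
    by_cases hx : x ∈ S <;> simp [hx]
  simp_rw [hpr]
  unfold mass
  rw [PMF.toOuterMeasure_apply, ENNReal.tsum_toReal_eq (fun x => ?_)]
  · refine tsum_congr fun x => ?_
    by_cases hx : x ∈ S
    · simp [hx]
    · simp [hx]
  · exact ((Set.indicator_le_self S D x).trans_lt (PMF.apply_lt_top D x)).ne

/-- The crux with the time bound on the tests DROPPED, for an arbitrary count function `N`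
(abstract form of `PseudorandomTwinsAboveWithoutPolyTime`): contradictory. [folklore] -/
theorem no_twins_against_unbounded_tests (N : List Bool → ℕ) (D₀ D₁ : Ensemble) (t : ℕ → ℕ)
    (hind : ∀ A : RandAlg (List Bool) Bool, Tendsto (fun n : ℕ =>
      |(∑' x : List Bool, ((D₀ n) x).toReal * A.pr id x {b | b = true}) -
        (∑' x : List Bool, ((D₁ n) x).toReal * A.pr id x {b | b = true})|) atTop (𝓝 0))
    (h₀ : Tendsto (fun n : ℕ => D₀.prob n {x | 8 * t n ≤ N x}) atTop (𝓝 1))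
    (h₁ : Tendsto (fun n : ℕ => D₁.prob n {x | 0 < N x ∧ N x ≤ t n}) atTop (𝓝 1)) : False := by
  classical
  refine no_setwise_indistinguishable_far_pair D₀ D₁ (fun n => {x | 8 * t n ≤ N x})
    (fun n => {x | 0 < N x ∧ N x ≤ t n}) ?_ h₀ h₁ ?_
  · intro n
    rw [Set.disjoint_left]
    rintro x (hx : 8 * t n ≤ N x) ⟨hpos, hle⟩
    omega
  · intro S
    have h' := hind (RandAlg.ofDet fun x => decide (x ∈ S))
    simp only [tsum_indicatorTest_eq_mass] at h'
    exact h'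

/-! ## (a) Load-bearing hypothesis: the crux without the time bound on the tests is FALSE -/

open scoped Classical in
/-- `PseudorandomTwinsAbove` with the hypothesis `A.IsPolyTime id encodeBool` of clause (i)
DROPPED (tests = every `RandAlg (List Bool) Bool`, still index-free). Verbatim otherwise.
[this work] -/
def PseudorandomTwinsAboveWithoutPolyTime : Prop :=
  ∃ Δ p q : ℕ, 3 ≤ Δ ∧ 0 < q ∧ ((Δ : ℝ) - 1) ^ (Δ - 1) / ((Δ : ℝ) - 2) ^ Δ < (p : ℝ) / q ∧ ∃ D₀ D₁ : Literature.Computability.MetaComplexity.Ensemble, D₀.IsPolySamplable ∧ D₁.IsPolySamplable ∧ (∀ A : Literature.Computability.Complexity.RandAlg (List Bool) Bool, Filter.Tendsto (fun n : ℕ => |(∑' x : List Bool, ((D₀ n) x).toReal * A.pr id x {b | b = true}) - (∑' x : List Bool, ((D₁ n) x).toReal * A.pr id x {b | b = true})|) Filter.atTop (nhds 0)) ∧ ∃ t : ℕ → ℕ, Filter.Tendsto (fun n : ℕ => D₀.prob n {x | 8 * t n ≤ (match Literature.Computability.Complexity.encodingGraph.decode x with | none => 0 | some G => if G.2.maxDegree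 ≤ Δ then ∑ I : Finset (Fin G.1), (if G.2.IsIndepSet (↑I : Set (Fin G.1)) then p ^ I.card * q ^ (G.1 - I.card) else 0) else 0)}) Filter.atTop (nhds 1) ∧ Filter.Tendsto (fun n : ℕ => D₁.prob n {x | 0 < (match Literature.Computability.Complexity.encodingGraph.decode x with | none => 0 | some G => if G.2.maxDegree ≤ Δ then ∑ I : Finset (Fin G.1), (if G.2.IsIndepSet (↑I : Set (Fin G.1)) then p ^ I.card * q ^ (G.1 - I.card) else 0) else 0) ∧ (match Literature.Computability.Complexity.encodingGraph.decode x with | none => 0 | some G => if G.2.maxDegree ≤ Δ then ∑ I : Finset (Fin G.1), (if G.2.IsIndepSet (↑I : Set (Fin G.1)) then p ^ I.card * q ^ (G.1 - I.card) else 0) else 0) ≤ t n}) Filter.atTop (nhds 1)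

/-- ANY PROOF OF THE CRUX MUST USE THE TIME BOUND ON THE TESTS: without it the statement is
false, even though the tests remain index-free (they never see `n`). Witness: the single set `S`
of `no_setwise_indistinguishable_far_pair`, run as the deterministic test `1_S` (`RandAlg.ofDet`,
no coins). [this work] -/
theorem pseudorandomTwinsAbove_false_without_polyTime : ¬ PseudorandomTwinsAboveWithoutPolyTime := by
  rintro ⟨Δ, p, q, -, -, -, D₀, D₁, -, -, hind, t, h₀, h₁⟩
  exact no_twins_against_unbounded_tests _ D₀ D₁ t hind h₀ h₁

/-- Sanity link: the crux is exactly the `WithoutPolyTime` variant with the extra hypothesis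
`A.IsPolyTime id encodeBool` in clause (i); in particular the crux trivially implies nothing
here and the variant implies the crux. [this work] -/
theorem withoutPolyTime_implies_crux :
    PseudorandomTwinsAboveWithoutPolyTime →
      Summit.PneNP.PneNP.Theses.PhaseTwins.PseudorandomTwinsAbove := by
  rintro ⟨Δ, p, q, hΔ, hq, hlam, D₀, D₁, hs₀, hs₁, hind, t, h₀, h₁⟩
  exact ⟨Δ, p, q, hΔ, hq, hlam, D₀, D₁, hs₀, hs₁, fun A _ => hind A, t, h₀, h₁⟩

/-! ## (a') The same for the INDEX-AWARE repair of clause (i) proposed in route review -/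

/-- Acceptance functional of the index-aware deterministic test `z ↦ 1_S((boolUnpair z).2)` run on
`boolPair (unaryEncodeNat n) x`: again the mass of `S`. [folklore] -/
theorem tsum_indexedIndicatorTest_eq_mass (D : PMF (List Bool)) (S : Set (List Bool))
    [DecidablePred (· ∈ S)] (n : ℕ) :
    ∑' x, (D x).toReal *
        (RandAlg.ofDet fun z => decide ((boolUnpair z).2 ∈ S)).pr id
          (boolPair (Computability.unaryEncodeNat n) x) {b | b = true}
      = mass D S := by
  classical
  have hpr : ∀ x, (RandAlg.ofDet fun z => decide ((boolUnpair z).2 ∈ S)).pr id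
      (boolPair (Computability.unaryEncodeNat n) x) {b | b = true} = if x ∈ S then 1 else 0 := by
    intro x
    rw [RandAlg.pr_ofDet]
    by_cases hx : x ∈ S <;> simp [hx, boolUnpair_boolPair]
  simp_rw [hpr]
  unfold mass
  rw [PMF.toOuterMeasure_apply, ENNReal.tsum_toReal_eq (fun x => ?_)]
  · refine tsum_congr fun x => ?_
    by_cases hx : x ∈ S
    · simp [hx]
    · simp [hx]
  · exact ((Set.indicator_le_self S D x).trans_lt (PMF.apply_lt_top D x)).ne

/-- Abstract form for INDEX-AWARE unbounded tests (the reviewers' repair `A.pr id (boolPair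
(unaryEncodeNat n) x) {true}` of clause (i), with the time bound dropped): contradictory as well —
the index does not help the twins, the set `S` ignores it. [this work] -/
theorem no_twins_against_unbounded_indexed_tests (N : List Bool → ℕ) (D₀ D₁ : Ensemble)
    (t : ℕ → ℕ)
    (hind : ∀ A : RandAlg (List Bool) Bool, Tendsto (fun n : ℕ =>
      |(∑' x : List Bool, ((D₀ n) x).toReal *
          A.pr id (boolPair (Computability.unaryEncodeNat n) x) {b | b = true}) -
        (∑' x : List Bool, ((D₁ n) x).toReal *
          A.pr id (boolPair (Computability.unaryEncodeNat n) x) {b | b = true})|) atTop (𝓝 0))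
    (h₀ : Tendsto (fun n : ℕ => D₀.prob n {x | 8 * t n ≤ N x}) atTop (𝓝 1))
    (h₁ : Tendsto (fun n : ℕ => D₁.prob n {x | 0 < N x ∧ N x ≤ t n}) atTop (𝓝 1)) : False := by
  classical
  refine no_setwise_indistinguishable_far_pair D₀ D₁ (fun n => {x | 8 * t n ≤ N x})
    (fun n => {x | 0 < N x ∧ N x ≤ t n}) ?_ h₀ h₁ ?_
  · intro n
    rw [Set.disjoint_left]
    rintro x (hx : 8 * t n ≤ N x) ⟨hpos, hle⟩
    omega
  · intro S
    have h' := hind (RandAlg.ofDet fun z => decide ((boolUnpair z).2 ∈ S))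
    simp only [tsum_indexedIndicatorTest_eq_mass] at h'
    exact h'

open scoped Classical in
/-- The reviewers' INDEX-AWARE repair of the crux (clause (i) with `A.pr id (boolPair
(unaryEncodeNat n) x) {true}`), with the time bound on the tests dropped. [this work] -/
def PseudorandomTwinsAboveIndexedWithoutPolyTime : Prop :=
  ∃ Δ p q : ℕ, 3 ≤ Δ ∧ 0 < q ∧ ((Δ : ℝ) - 1) ^ (Δ - 1) / ((Δ : ℝ) - 2) ^ Δ < (p : ℝ) / q ∧ ∃ D₀ D₁ : Literature.Computability.MetaComplexity.Ensemble, D₀.IsPolySamplable ∧ D₁.IsPolySamplable ∧ (∀ A : Literature.Computability.Complexity.RandAlg (List Bool) Bool, Filter.Tendsto (fun n : ℕ => |(∑' x : List Bool, ((D₀ n) x).toReal * A.pr id (boolPair (Computability.unaryEncodeNat n) x) {b | b = true}) - (∑' x : List Bool, ((D₁ n) x).toReal * A.pr id (boolPair (Computability.unaryEncodeNat n) x) {b | b = true})|) Filter.atTop (nhds 0)) ∧ ∃ t : ℕ → ℕ, Filter.Tendsto (fun n : ℕ => D₀.prob n {x | 8 * t n ≤ (match Literature.Computability.Complexity.encodingGraph.decode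 x with | none => 0 | some G => if G.2.maxDegree ≤ Δ then ∑ I : Finset (Fin G.1), (if G.2.IsIndepSet (↑I : Set (Fin G.1)) then p ^ I.card * q ^ (G.1 - I.card) else 0) else 0)}) Filter.atTop (nhds 1) ∧ Filter.Tendsto (fun n : ℕ => D₁.prob n {x | 0 < (match Literature.Computability.Complexity.encodingGraph.decode x with | none => 0 | some G => if G.2.maxDegree ≤ Δ then ∑ I : Finset (Fin G.1), (if G.2.IsIndepSet (↑I : Set (Fin G.1)) then p ^ I.card * q ^ (G.1 - I.card) else 0) else 0) ∧ (match Literature.Computability.Complexity.encodingGraph.decode x with | none => 0 | some G => if G.2.maxDegree ≤ Δ then ∑ I : Finset (Fin G.1), (if G.2.IsIndepSet (↑I : Set (Fin G.1)) then p ^ I.card * q ^ (G.1 - I.card) else 0) else 0) ≤ t n}) Filter.atTop (nhds 1)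

/-- The index-aware repair does not change the verdict: without the time bound it is false too.
[this work] -/
theorem pseudorandomTwinsAboveIndexed_false_without_polyTime :
    ¬ PseudorandomTwinsAboveIndexedWithoutPolyTime := by
  rintro ⟨Δ, p, q, -, -, -, D₀, D₁, -, -, hind, t, h₀, h₁⟩
  exact no_twins_against_unbounded_indexed_tests _ D₀ D₁ t hind h₀ h₁

/-! ## (a'') The positivity conjunct `0 < N x` is what excludes junk witnesses -/

/-- A junk string: `[0,1,1]` is `boolPair [] [1]`, i.e. vertex count `0` with a payload of
length `1 ≠ 0·0`, so `encodingGraph.decode` fails and the hard-core count is `0`. [folklore] -/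
theorem decode_junk : encodingGraph.decode [false, true, true] = none := by
  rfl

/-- Point masses on a fixed string are polynomial-time samplable (coin-free constant sampler;
`PolyTimeComputable.const`, `RandAlg.IsPolyTime.ofDet_holds`). [folklore] -/
theorem isPolySamplable_pure (w : List Bool) : Ensemble.IsPolySamplable fun _ => PMF.pure w :=
  ⟨RandAlg.ofDet fun _ => w,
    RandAlg.IsPolyTime.ofDet_holds (PolyTimeComputable.const Computability.unaryEncodeNat id w),
    fun _ => RandAlg.outputPMF_ofDet _ _ _⟩

open scoped Classical in
/-- The crux with the conjunct `0 < N x` DROPPED from the `D₁`-event of clause (ii). [this work] -/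
def PseudorandomTwinsAboveWithoutPositivity : Prop :=
  ∃ Δ p q : ℕ, 3 ≤ Δ ∧ 0 < q ∧ ((Δ : ℝ) - 1) ^ (Δ - 1) / ((Δ : ℝ) - 2) ^ Δ < (p : ℝ) / q ∧ ∃ D₀ D₁ : Literature.Computability.MetaComplexity.Ensemble, D₀.IsPolySamplable ∧ D₁.IsPolySamplable ∧ (∀ A : Literature.Computability.Complexity.RandAlg (List Bool) Bool, A.IsPolyTime (id : List Bool → List Bool) Computability.encodeBool → Filter.Tendsto (fun n : ℕ => |(∑' x : List Bool, ((D₀ n) x).toReal * A.pr id x {b | b = true}) - (∑' x : List Bool, ((D₁ n) x).toReal * A.pr id x {b | b = true})|) Filter.atTop (nhds 0)) ∧ ∃ t : ℕ → ℕ, Filter.Tendsto (fun n : ℕ => D₀.prob n {x | 8 * t n ≤ (match Literature.Computability.Complexity.encodingGraph.decode x with | none => 0 | some G => if G.2.maxDegree ≤ Δ then ∑ I : Finset (Fin G.1), (if G.2.IsIndepSet (↑I : Set (Fin G.1)) then p ^ I.card * q ^ (G.1 - I.card) else 0) else 0)}) Filter.atTop (nhds 1) ∧ Filter.Tendsto (fun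 n : ℕ => D₁.prob n {x | (match Literature.Computability.Complexity.encodingGraph.decode x with | none => 0 | some G => if G.2.maxDegree ≤ Δ then ∑ I : Finset (Fin G.1), (if G.2.IsIndepSet (↑I : Set (Fin G.1)) then p ^ I.card * q ^ (G.1 - I.card) else 0) else 0) ≤ t n}) Filter.atTop (nhds 1)

/-- WITHOUT THE POSITIVITY CONJUNCT THE CRUX IS JUNK-TRUE: `D₀ = D₁ =` the point mass on the junk
string `[0,1,1]` (hard-core count `0`), threshold `t = 0`. Both events have probability `1`,
and identical ensembles are indistinguishable by every test. So `0 < N x` (equivalently: `D₁`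
lives on the promise) is the clause that forces the two ensembles apart; any witness of the real
crux must produce valid bounded-degree graph codes on the `D₁` side. [this work] -/
theorem pseudorandomTwinsAboveWithoutPositivity_holds : PseudorandomTwinsAboveWithoutPositivity := by
  classical
  refine ⟨3, 5, 1, le_rfl, Nat.one_pos, by norm_num, fun _ => PMF.pure [false, true, true],
    fun _ => PMF.pure [false, true, true], isPolySamplable_pure _, isPolySamplable_pure _,
    fun A _ => by simp, fun _ => 0, ?_, ?_⟩
  · refine tendsto_const_nhds.congr fun n => ?_
    simp only [Nat.mul_zero, Nat.zero_le, Set.setOf_true]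
    simp [Ensemble.prob]
  · refine tendsto_const_nhds.congr fun n => ?_
    have hmem : [false, true, true] ∈ {x : List Bool | (match
        Literature.Computability.Complexity.encodingGraph.decode x with
        | none => 0
        | some G => if G.2.maxDegree ≤ 3 then ∑ I : Finset (Fin G.1),
            (if G.2.IsIndepSet (↑I : Set (Fin G.1)) then 5 ^ I.card * 1 ^ (G.1 - I.card) else 0)
          else 0) ≤ (0 : ℕ)} := by
      rw [Set.mem_setOf_eq, decode_junk]
    simp only [Ensemble.prob, PMF.toOuterMeasure_pure_apply, hmem, if_true]
    simp

/-! ## (b) `coinLen` is unconstrained advice -/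

/-- `RandAlg.IsPolyTime` only bounds `coinLen` polynomially: replacing the coin budget of a PPT
test by ANY polynomially bounded function (computable or not) keeps it PPT. Hence the test class
of clause (i) is "PPT with the advice `coinLen |x|`", i.e. `O(log |x|)` advice bits read off
`|r|`. [folklore] -/
theorem isPolyTime_coinLen_irrelevant (A : RandAlg (List Bool) Bool)
    (hA : A.IsPolyTime (id : List Bool → List Bool) Computability.encodeBool)
    (f : ℕ → ℕ) (pf : Polynomial ℕ) (hf : ∀ n, f n ≤ pf.eval n) :
    ({ run := A.run, coinLen := f } : RandAlg (List Bool) Bool).IsPolyTime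
      (id : List Bool → List Bool) Computability.encodeBool :=
  ⟨hA.1, pf, hf⟩

/-! ## (c) Pigeonhole kernel: finitely many bounded tests always admit twins along a chain -/

/-- Against a FINITE family of `[0,1]`-valued tests, among more than `(g+1)^{#tests}` inputs two
are `1/g`-indistinguishable by every test (box pigeonhole on `⌊g·aᵢ(x)⌋`). Along a chain with
`N(x_{j+1}) ≥ 8·N(x_j)` the pair is a factor-`8` twin. This is why the crux needs BOTH an
infinite (uniform) test family and samplable ensembles to be non-trivial: point masses on such a
pair fool any finite list of tests, and a diagonal enumeration of PPT tests would prove the crux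
minus `IsPolySamplable`. [folklore] -/
theorem exists_close_pair_of_card_lt {ι Y : Type*} [Fintype ι] (a : ι → Y → ℝ)
    (ha : ∀ i y, a i y ∈ Set.Icc (0 : ℝ) 1) (g : ℕ) (hg : 0 < g) {M : ℕ} (xs : Fin M → Y)
    (hM : (g + 1) ^ Fintype.card ι < M) :
    ∃ j k : Fin M, j ≠ k ∧ ∀ i, |a i (xs j) - a i (xs k)| ≤ 1 / g := by
  classical
  -- the cell of an input: coordinatewise ⌊g · aᵢ⌋ ∈ {0, …, g}
  have hcell : ∀ i y, ⌊(g : ℝ) * a i y⌋₊ < g + 1 := by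
    intro i y
    have h1 : (g : ℝ) * a i y ≤ g := by
      have := (ha i y).2
      nlinarith [(Nat.cast_nonneg g : (0 : ℝ) ≤ g)]
    have h2 : ⌊(g : ℝ) * a i y⌋₊ ≤ g := by
      refine Nat.floor_le_of_le ?_
      exact_mod_cast h1
    omega
  let cell : Fin M → (ι → Fin (g + 1)) := fun j i => ⟨⌊(g : ℝ) * a i (xs j)⌋₊, hcell i (xs j)⟩
  have hcard : Fintype.card (ι → Fin (g + 1)) < Fintype.card (Fin M) := by
    simpa [Fintype.card_fun, Fintype.card_fin] using hM
  obtain ⟨j, k, hjk, hjk'⟩ := Fintype.exists_ne_map_eq_of_card_lt cell hcard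
  refine ⟨j, k, hjk, fun i => ?_⟩
  have hfl : ⌊(g : ℝ) * a i (xs j)⌋₊ = ⌊(g : ℝ) * a i (xs k)⌋₊ := by
    have := congrArg (fun c : ι → Fin (g + 1) => (c i : ℕ)) hjk'
    simpa [cell] using this
  have hgpos : (0 : ℝ) < g := by exact_mod_cast hg
  have h0j : 0 ≤ (g : ℝ) * a i (xs j) := mul_nonneg hgpos.le (ha i (xs j)).1
  have h0k : 0 ≤ (g : ℝ) * a i (xs k) := mul_nonneg hgpos.le (ha i (xs k)).1
  have hj1 := Nat.floor_le h0j
  have hj2 := Nat.lt_floor_add_one ((g : ℝ) * a i (xs j))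
  have hk1 := Nat.floor_le h0k
  have hk2 := Nat.lt_floor_add_one ((g : ℝ) * a i (xs k))
  rw [hfl] at hj1 hj2
  have habs : |(g : ℝ) * a i (xs j) - (g : ℝ) * a i (xs k)| ≤ 1 := by
    rw [abs_le]; constructor <;> linarith
  rw [← mul_sub, abs_mul, abs_of_pos hgpos] at habs
  rw [le_div_iff₀ hgpos, mul_comm]
  exact habs


/-! # Cycle 2 (2026-08-16): regular tests, length advice, escape, junk cylinder

Verbatim (up to the `mass` abbreviation of this file) the content of the landed
`Negative/RegularTests.lean` (p75931) and `Negative/EscapeAndJunk.lean` (p76683). -/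

/-! ## The test class contains every regular test -/

/-- DFA acceptance `x ↦ [M accepts x]` is polynomial-time computable (output one bit,
`encodeBool`): run the DFA as a finite-state transducer that emits nothing and prepends the
acceptance bit of its final state (`FST.polyTimeComputable_eval`). [folklore] -/
theorem polyTimeComputable_dfa {σ : Type} [Fintype σ] (M : DFA Bool σ)
    [DecidablePred (· ∈ M.accept)] :
    PolyTimeComputable (id : List Bool → List Bool) Computability.encodeBool
      (fun x => decide (M.eval x ∈ M.accept)) := by
  let T : FST σ Bool Bool :=
    { init := M.start
      step := fun s a => (M.step s a, [])
      front := fun s => [decide (s ∈ M.accept)]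
      keep := fun _ => false }
  have hrun : ∀ (x : List Bool) (s : σ), (T.run s x).1 = M.evalFrom s x := by
    intro x
    induction x with
    | nil => intro s; rfl
    | cons a x ih => intro s; exact ih (M.step s a)
  have heval : ∀ x, T.eval x = [decide (M.eval x ∈ M.accept)] := by
    intro x
    have h1 : T.eval x = [decide ((T.run M.start x).1 ∈ M.accept)] := rfl
    rw [h1, hrun]
    rfl
  exact PolyTimeComputable.of_encode_eq (f := T.eval) (ea := id) (eb := id) id (fun _ => rfl)
    (fun x => by rw [heval]; rfl) T.polyTimeComputable_eval

/-- Hence the deterministic regular test `1_{L(M)}` is a PPT test of clause (i)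
(`RandAlg.IsPolyTime.ofDet_holds`). [folklore] -/
theorem isPolyTime_ofDet_dfa {σ : Type} [Fintype σ] (M : DFA Bool σ)
    [DecidablePred (· ∈ M.accept)] :
    (RandAlg.ofDet fun x => decide (M.eval x ∈ M.accept)).IsPolyTime
      (id : List Bool → List Bool) Computability.encodeBool :=
  RandAlg.IsPolyTime.ofDet_holds (polyTimeComputable_dfa M)

/-- Every finite set of strings is recognised by a finite DFA (Myhill–Nerode: the left
quotients of a finite language are subsets of its finite set of suffixes). [folklore] -/
theorem exists_dfa_of_finite {S : Set (List Bool)} (hS : S.Finite) :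
    ∃ (σ : Type) (_ : Fintype σ) (M : DFA Bool σ), ∀ x, M.eval x ∈ M.accept ↔ x ∈ S := by
  let L : Language Bool := S
  have hsuff : {y : List Bool | ∃ w ∈ S, y <:+ w}.Finite := by
    have heq : {y : List Bool | ∃ w ∈ S, y <:+ w} = ⋃ w ∈ S, {y | y <:+ w} := by
      ext y; simp
    rw [heq]
    exact hS.biUnion fun w _ =>
      (List.finite_toSet w.tails).subset fun y (hy : y <:+ w) => (List.mem_tails _ _).2 hy
  have hrange : (Set.range L.leftQuotient).Finite := by
    refine (hsuff.finite_subsets).subset ?_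
    rintro _ ⟨x, rfl⟩ y (hy : x ++ y ∈ S)
    exact ⟨x ++ y, hy, List.suffix_append x y⟩
  obtain ⟨σ, hσ, M, hM⟩ := Language.IsRegular.of_finite_range_leftQuotient hrange
  refine ⟨σ, hσ, M, fun x => ?_⟩
  change x ∈ M.accepts ↔ x ∈ L
  rw [hM]

/-- Finite-set indicators are polynomial-time tests. [folklore] -/
theorem exists_polyTime_test_of_finite {S : Set (List Bool)} (hS : S.Finite)
    [DecidablePred (· ∈ S)] :
    (RandAlg.ofDet fun x => decide (x ∈ S)).IsPolyTime
      (id : List Bool → List Bool) Computability.encodeBool := by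
  obtain ⟨σ, hσ, M, hM⟩ := exists_dfa_of_finite hS
  classical
  have h := isPolyTime_ofDet_dfa M
  have hfun : (fun x => decide (M.eval x ∈ M.accept)) = fun x => decide (x ∈ S) :=
    funext fun x => decide_eq_decide.2 (hM x)
  rw [hfun] at h
  exact h

/-! ## The test class contains every length-set test (coin-length advice) -/

/-- A randomized algorithm whose output does not depend on the coins (of the prescribed length)
has a Dirac output law. [folklore] -/
theorem pr_eq_of_forall_run {α β : Type} (A : RandAlg α β) (ea : α → List Bool) (x : α) (b : β)
    (h : ∀ r : List Bool, r.length = A.coinLen (ea x).length → A.run x r = b) (E : Set β)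
    [Decidable (b ∈ E)] : A.pr ea x E = if b ∈ E then 1 else 0 := by
  have hf : (fun r : List.Vector Bool (A.coinLen (ea x).length) => A.run x r.toList) =
      fun _ => b :=
    funext fun r => h r.toList r.toList_length
  have hmap : A.outputPMF ea x = PMF.pure b := by
    unfold RandAlg.outputPMF
    rw [hf]
    exact PMF.map_const _ _
  rw [RandAlg.pr, hmap, PMF.toOuterMeasure_pure_apply]
  split_ifs <;> simp

/-- THE COIN-FLAG MACHINE IS PPT FOR EVERY POLYNOMIALLY BOUNDED COIN BUDGET. It ignores `x` and
reports whether its coin string is non-empty: the second pair projection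
(`polyTimeComputable_snd_holds`) followed by a two-state DFA, composed by
`PolyTimeComputable.comp_holds`. Since `RandAlg.IsPolyTime` constrains `coinLen` only by a
polynomial bound, `coinLen` may be ANY `{0,1}`-valued function of the input length. [folklore] -/
theorem isPolyTime_coinFlag (c : ℕ → ℕ) (pc : Polynomial ℕ) (hc : ∀ n, c n ≤ pc.eval n) :
    ({ run := fun _ r => !r.isEmpty, coinLen := c } : RandAlg (List Bool) Bool).IsPolyTime
      (id : List Bool → List Bool) Computability.encodeBool := by
  refine ⟨?_, pc, hc⟩
  have hsnd : PolyTimeComputable (fun p : List Bool × List Bool => boolPair (id p.1) p.2)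
      (id : List Bool → List Bool) (Prod.snd : List Bool × List Bool → List Bool) :=
    PolyTimeComputable.of_encode_eq (f := (Prod.snd : List Bool × List Bool → List Bool)) id
      (fun _ => rfl) (fun _ => rfl) polyTimeComputable_snd_holds
  -- the two-state DFA "some symbol was read"
  let M : DFA Bool Bool := ⟨fun _ _ => true, false, {b | b = true}⟩
  have hfold : ∀ (r : List Bool) (s : Bool), M.evalFrom s r = (s || !r.isEmpty) := by
    intro r
    induction r with
    | nil => intro s; simp
    | cons a r ih =>
      intro s
      rw [DFA.evalFrom_cons, ih]
      simp [M]
  have hbit : ∀ r : List Bool, decide (M.eval r ∈ M.accept) = !r.isEmpty := by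
    intro r
    have h1 : M.eval r = M.evalFrom false r := rfl
    rw [h1, hfold]
    cases r <;> simp [M]
  have hne : PolyTimeComputable (id : List Bool → List Bool) Computability.encodeBool
      (fun r : List Bool => !r.isEmpty) :=
    PolyTimeComputable.of_encode_eq (f := fun r => decide (M.eval r ∈ M.accept)) (ea := id)
      (eb := Computability.encodeBool) id (fun _ => rfl)
      (fun r => congrArg Computability.encodeBool (hbit r)) (polyTimeComputable_dfa M)
  exact PolyTimeComputable.comp_holds hne hsnd

/-- Acceptance probability of the coin-flag machine: `1` if it receives a coin, `0` if not.
[folklore] -/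
theorem pr_coinFlag (c : ℕ → ℕ) (x : List Bool) :
    ({ run := fun _ r => !r.isEmpty, coinLen := c } : RandAlg (List Bool) Bool).pr id x
      {b | b = true} = if 0 < c x.length then 1 else 0 := by
  rw [pr_eq_of_forall_run _ id x (decide (0 < c x.length)) ?_ {b | b = true}]
  · by_cases h : 0 < c x.length <;> simp [h]
  · intro r hr
    change (!r.isEmpty) = decide (0 < c x.length)
    change r.length = c x.length at hr
    cases r with
    | nil => simp at hr; simp [← hr]
    | cons a r => simp at hr ⊢; omega

/-! ## Acceptance functionals are masses -/

/-- If a test accepts `x` with probability `1_S(x)`, its acceptance functional against `D` is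
`D(S)`. [folklore] -/
theorem tsum_mul_indicator_eq_mass (D : PMF (List Bool)) (S : Set (List Bool))
    [DecidablePred (· ∈ S)] (a : List Bool → ℝ) (ha : ∀ x, a x = if x ∈ S then 1 else 0) :
    ∑' x, (D x).toReal * a x = (PMF.toOuterMeasure D S).toReal := by
  classical
  simp_rw [ha]
  rw [PMF.toOuterMeasure_apply, ENNReal.tsum_toReal_eq (fun x => ?_)]
  · refine tsum_congr fun x => ?_
    by_cases hx : x ∈ S
    · simp [hx]
    · simp [hx]
  · exact ((Set.indicator_le_self S D x).trans_lt (PMF.apply_lt_top D x)).ne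

/-- Acceptance functional of a DFA test = mass of its language. [folklore] -/
theorem tsum_dfaTest_eq_mass (D : PMF (List Bool)) {σ : Type} (M : DFA Bool σ)
    [DecidablePred (· ∈ M.accept)] :
    ∑' x, (D x).toReal * (RandAlg.ofDet fun x => decide (M.eval x ∈ M.accept)).pr id x
      {b | b = true} = (PMF.toOuterMeasure D {x | M.eval x ∈ M.accept}).toReal := by
  classical
  refine tsum_mul_indicator_eq_mass D {x | M.eval x ∈ M.accept} _ fun x => ?_
  rw [RandAlg.pr_ofDet]
  by_cases hx : M.eval x ∈ M.accept <;> simp [hx]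

/-- Acceptance functional of the coin-flag test with budget `1_T` = mass of `{x : |x| ∈ T}`.
[folklore] -/
theorem tsum_coinFlag_eq_mass (D : PMF (List Bool)) (T : Set ℕ) [DecidablePred (· ∈ T)] :
    ∑' x, (D x).toReal *
      ({ run := fun _ r => !r.isEmpty, coinLen := fun ℓ => if ℓ ∈ T then 1 else 0 } :
        RandAlg (List Bool) Bool).pr id x {b | b = true}
      = (PMF.toOuterMeasure D {x | x.length ∈ T}).toReal := by
  classical
  refine tsum_mul_indicator_eq_mass D {x | x.length ∈ T} _ fun x => ?_
  rw [pr_coinFlag]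
  by_cases hx : x.length ∈ T <;> simp [hx]

/-! ## Consequences of clause (i): regular languages and length sets merge -/

/-- CLAUSE (i) FORCES EQUAL ASYMPTOTIC MASS ON EVERY REGULAR LANGUAGE. [this work] -/
theorem dfa_merge (D₀ D₁ : Ensemble)
    (hind : ∀ A : RandAlg (List Bool) Bool,
      A.IsPolyTime (id : List Bool → List Bool) Computability.encodeBool →
      Tendsto (fun n : ℕ => |(∑' x : List Bool, ((D₀ n) x).toReal * A.pr id x {b | b = true}) -
        (∑' x : List Bool, ((D₁ n) x).toReal * A.pr id x {b | b = true})|) atTop (𝓝 0))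
    {σ : Type} [Fintype σ] (M : DFA Bool σ) :
    Tendsto (fun n => |D₀.prob n {x | M.eval x ∈ M.accept} - D₁.prob n {x | M.eval x ∈ M.accept}|)
      atTop (𝓝 0) := by
  classical
  have h := hind _ (isPolyTime_ofDet_dfa M)
  simp only [tsum_dfaTest_eq_mass] at h
  exact h

/-- CLAUSE (i) FORCES EQUAL ASYMPTOTIC MASS ON EVERY FINITE SET. [this work] -/
theorem finite_merge (D₀ D₁ : Ensemble)
    (hind : ∀ A : RandAlg (List Bool) Bool,
      A.IsPolyTime (id : List Bool → List Bool) Computability.encodeBool →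
      Tendsto (fun n : ℕ => |(∑' x : List Bool, ((D₀ n) x).toReal * A.pr id x {b | b = true}) -
        (∑' x : List Bool, ((D₁ n) x).toReal * A.pr id x {b | b = true})|) atTop (𝓝 0))
    {S : Set (List Bool)} (hS : S.Finite) :
    Tendsto (fun n => |D₀.prob n S - D₁.prob n S|) atTop (𝓝 0) := by
  obtain ⟨σ, hσ, M, hM⟩ := exists_dfa_of_finite hS
  have hset : {x | M.eval x ∈ M.accept} = S := Set.ext hM
  have h := dfa_merge D₀ D₁ hind M
  rw [hset] at h
  exact h

/-- CLAUSE (i) FORCES THE LENGTH LAWS TO MERGE SETWISE: for every `T ⊆ ℕ` (computable or not)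
`|D₀ n (|x| ∈ T) − D₁ n (|x| ∈ T)| → 0` — the coin-length advice reads `[|x| ∈ T]`. [this work] -/
theorem lengthSet_merge (D₀ D₁ : Ensemble)
    (hind : ∀ A : RandAlg (List Bool) Bool,
      A.IsPolyTime (id : List Bool → List Bool) Computability.encodeBool →
      Tendsto (fun n : ℕ => |(∑' x : List Bool, ((D₀ n) x).toReal * A.pr id x {b | b = true}) -
        (∑' x : List Bool, ((D₁ n) x).toReal * A.pr id x {b | b = true})|) atTop (𝓝 0))
    (T : Set ℕ) :
    Tendsto (fun n => |D₀.prob n {x | x.length ∈ T} - D₁.prob n {x | x.length ∈ T}|)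
      atTop (𝓝 0) := by
  classical
  have hA := isPolyTime_coinFlag (fun ℓ => if ℓ ∈ T then 1 else 0) 1
    (fun n => by split_ifs <;> simp)
  have h := hind _ hA
  simp only [tsum_coinFlag_eq_mass] at h
  exact h

/-- NO TWINS ON DISJOINT LENGTH SETS. If the lengths of `D₀ n`-samples concentrate on `T₀ n` and
those of `D₁ n`-samples on `T₁ n` with `T₀ n ∩ T₁ n = ∅`, clause (i) fails: by `lengthSet_merge`
the length laws (push-forwards to `ℕ`) would be setwise indistinguishable while concentrating on
disjoint events, which the gliding hump `no_setwise_indistinguishable_far_pair` forbids. So a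
witness cannot pad YES- and NO-instances to different lengths, use codes of different sizes on
the two sides, etc. [this work] -/
theorem no_twins_on_disjoint_lengthSets (D₀ D₁ : Ensemble)
    (hind : ∀ A : RandAlg (List Bool) Bool,
      A.IsPolyTime (id : List Bool → List Bool) Computability.encodeBool →
      Tendsto (fun n : ℕ => |(∑' x : List Bool, ((D₀ n) x).toReal * A.pr id x {b | b = true}) -
        (∑' x : List Bool, ((D₁ n) x).toReal * A.pr id x {b | b = true})|) atTop (𝓝 0))
    (T₀ T₁ : ℕ → Set ℕ) (hT : ∀ n, Disjoint (T₀ n) (T₁ n))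
    (h₀ : Tendsto (fun n => D₀.prob n {x | x.length ∈ T₀ n}) atTop (𝓝 1))
    (h₁ : Tendsto (fun n => D₁.prob n {x | x.length ∈ T₁ n}) atTop (𝓝 1)) : False := by
  have hmap : ∀ (D : PMF (List Bool)) (S : Set ℕ),
      mass (D.map List.length) S = mass D {x | x.length ∈ S} := by
    intro D S
    unfold mass
    rw [PMF.toOuterMeasure_map_apply]
    rfl
  refine no_setwise_indistinguishable_far_pair (fun n => (D₀ n).map List.length)
    (fun n => (D₁ n).map List.length) T₀ T₁ hT ?_ ?_ ?_
  · simp only [hmap]; exact h₀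
  · simp only [hmap]; exact h₁
  · intro S
    simp only [hmap]
    exact lengthSet_merge D₀ D₁ hind S

/-- REFUTED VARIANT (corollary): twins living at DIFFERENT LENGTHS `ℓ₀ n ≠ ℓ₁ n` do not exist,
whatever the functions `ℓ₀, ℓ₁` (computable or not) — the test class sees `[|x| ∈ T]` for every
`T ⊆ ℕ`. [this work] -/
theorem no_twins_at_distinct_lengths (D₀ D₁ : Ensemble)
    (hind : ∀ A : RandAlg (List Bool) Bool,
      A.IsPolyTime (id : List Bool → List Bool) Computability.encodeBool →
      Tendsto (fun n : ℕ => |(∑' x : List Bool, ((D₀ n) x).toReal * A.pr id x {b | b = true}) -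
        (∑' x : List Bool, ((D₁ n) x).toReal * A.pr id x {b | b = true})|) atTop (𝓝 0))
    (ℓ₀ ℓ₁ : ℕ → ℕ) (hne : ∀ n, ℓ₀ n ≠ ℓ₁ n)
    (h₀ : Tendsto (fun n => D₀.prob n {x | x.length = ℓ₀ n}) atTop (𝓝 1))
    (h₁ : Tendsto (fun n => D₁.prob n {x | x.length = ℓ₁ n}) atTop (𝓝 1)) : False :=
  no_twins_on_disjoint_lengthSets D₀ D₁ hind (fun n => {ℓ₀ n}) (fun n => {ℓ₁ n})
    (fun n => Set.disjoint_singleton.2 (hne n)) (by simpa using h₀) (by simpa using h₁)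

/-! ## Consequences of clauses (i)+(ii): finite sets escape -/

/-- LENGTH / ATOM ESCAPE. Under clause (i) and the abstract clause (ii) (`D₀ n (U n) → 1`,
`D₁ n (V n) → 1`, `U n ∩ V n = ∅`) every finite set of strings has vanishing mass under BOTH
ensembles: singleton tests merge the point masses (`finite_merge`), and the key estimate
`mass_finset_le_of_disjoint` bounds `D₀ n (Φ)` by the pointwise discrepancy on `Φ` plus the
mass defects of `U n`, `V n`. [this work] -/
theorem finset_mass_tendsto_zero (D₀ D₁ : Ensemble)
    (hind : ∀ A : RandAlg (List Bool) Bool,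
      A.IsPolyTime (id : List Bool → List Bool) Computability.encodeBool →
      Tendsto (fun n : ℕ => |(∑' x : List Bool, ((D₀ n) x).toReal * A.pr id x {b | b = true}) -
        (∑' x : List Bool, ((D₁ n) x).toReal * A.pr id x {b | b = true})|) atTop (𝓝 0))
    (U V : ℕ → Set (List Bool)) (hUV : ∀ n, Disjoint (U n) (V n))
    (h₀ : Tendsto (fun n => D₀.prob n (U n)) atTop (𝓝 1))
    (h₁ : Tendsto (fun n => D₁.prob n (V n)) atTop (𝓝 1)) (Φ : Finset (List Bool)) :
    Tendsto (fun n => D₀.prob n ↑Φ) atTop (𝓝 0) ∧ Tendsto (fun n => D₁.prob n ↑Φ) atTop (𝓝 0) := by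
  -- pointwise discrepancy on Φ tends to 0 (singleton tests)
  have hd : Tendsto (fun n => ∑ x ∈ Φ, |(PMF.toOuterMeasure (D₀ n) {x}).toReal -
      (PMF.toOuterMeasure (D₁ n) {x}).toReal|) atTop (𝓝 0) := by
    have h' := tendsto_finsetSum Φ
      (fun x (_ : x ∈ Φ) => finite_merge D₀ D₁ hind (Set.finite_singleton x))
    simpa [Ensemble.prob] using h'
  have hd' : Tendsto (fun n => ∑ x ∈ Φ, |(PMF.toOuterMeasure (D₁ n) {x}).toReal -
      (PMF.toOuterMeasure (D₀ n) {x}).toReal|) atTop (𝓝 0) := by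
    refine hd.congr fun n => Finset.sum_congr rfl fun x _ => abs_sub_comm _ _
  have hU : Tendsto (fun n => 1 - D₀.prob n (U n)) atTop (𝓝 0) := by
    simpa using (tendsto_const_nhds (x := (1 : ℝ))).sub h₀
  have hV : Tendsto (fun n => 1 - D₁.prob n (V n)) atTop (𝓝 0) := by
    simpa using (tendsto_const_nhds (x := (1 : ℝ))).sub h₁
  constructor
  · have hup : Tendsto (fun n => (∑ x ∈ Φ, |(PMF.toOuterMeasure (D₀ n) {x}).toReal -
        (PMF.toOuterMeasure (D₁ n) {x}).toReal|) + (1 - D₁.prob n (V n)) + (1 - D₀.prob n (U n)))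
        atTop (𝓝 0) := by
      simpa using (hd.add hV).add hU
    refine tendsto_of_tendsto_of_tendsto_of_le_of_le tendsto_const_nhds hup
      (fun n => Ensemble.prob_nonneg _ _ _) (fun n => ?_)
    exact mass_finset_le_of_disjoint (D₀ n) (D₁ n) (hUV n) Φ
  · have hup : Tendsto (fun n => (∑ x ∈ Φ, |(PMF.toOuterMeasure (D₁ n) {x}).toReal -
        (PMF.toOuterMeasure (D₀ n) {x}).toReal|) + (1 - D₀.prob n (U n)) + (1 - D₁.prob n (V n)))
        atTop (𝓝 0) := by
      simpa using (hd'.add hU).add hV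
    refine tendsto_of_tendsto_of_tendsto_of_le_of_le tendsto_const_nhds hup
      (fun n => Ensemble.prob_nonneg _ _ _) (fun n => ?_)
    exact mass_finset_le_of_disjoint (D₁ n) (D₀ n) (hUV n).symm Φ

/-- In particular short strings carry no mass: for every `L`, `Dᵢ n {x : |x| ≤ L} → 0` for both
ensembles (the length-escape lemma behind glue 2723). [this work] -/
theorem shortStrings_mass_tendsto_zero (D₀ D₁ : Ensemble)
    (hind : ∀ A : RandAlg (List Bool) Bool,
      A.IsPolyTime (id : List Bool → List Bool) Computability.encodeBool →
      Tendsto (fun n : ℕ => |(∑' x : List Bool, ((D₀ n) x).toReal * A.pr id x {b | b = true}) -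
        (∑' x : List Bool, ((D₁ n) x).toReal * A.pr id x {b | b = true})|) atTop (𝓝 0))
    (U V : ℕ → Set (List Bool)) (hUV : ∀ n, Disjoint (U n) (V n))
    (h₀ : Tendsto (fun n => D₀.prob n (U n)) atTop (𝓝 1))
    (h₁ : Tendsto (fun n => D₁.prob n (V n)) atTop (𝓝 1)) (L : ℕ) :
    Tendsto (fun n => D₀.prob n {x | x.length ≤ L}) atTop (𝓝 0) ∧
      Tendsto (fun n => D₁.prob n {x | x.length ≤ L}) atTop (𝓝 0) := by
  have hfin := List.finite_length_le Bool L
  have h := finset_mass_tendsto_zero D₀ D₁ hind U V hUV h₀ h₁ hfin.toFinset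
  simpa only [Set.Finite.coe_toFinset] using h

/-! ## The junk cylinder `10{0,1}*`: hard-core count `1`, yet negligible for `D₁` -/

open scoped Classical in
/-- EVERY STRING `1 0 w` HAS HARD-CORE COUNT `1`: `boolUnpair (1 0 w) = ([], [])`, vertex count
`decodeNat [] = 0`, payload `[]` of the right length `0 · 0`, so it decodes to the empty graph on
`Fin 0` (max degree `0 ≤ Δ`), whose only independent set is `∅`. Hence the NO-event
`{0 < N ≤ t n}` of clause (ii) contains the cylinder `10{0,1}*` as soon as `t n ≥ 1`: the
positivity conjunct excludes the `N = 0` junk (`decode_junk`) but not this one. [this work] -/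
theorem hardcoreCount_junk (Δ p q : ℕ) (w : List Bool) :
    (match Literature.Computability.Complexity.encodingGraph.decode (true :: false :: w) with
      | none => 0
      | some G => if G.2.maxDegree ≤ Δ then ∑ I : Finset (Fin G.1),
          (if G.2.IsIndepSet (↑I : Set (Fin G.1)) then p ^ I.card * q ^ (G.1 - I.card) else 0)
        else 0) = 1 := by
  obtain ⟨G, hG⟩ : ∃ G : SimpleGraph (Fin 0),
      Literature.Computability.Complexity.encodingGraph.decode (true :: false :: w) = some ⟨0, G⟩ :=
    ⟨_, rfl⟩
  simp only [hG]
  have hdeg : G.maxDegree ≤ Δ := SimpleGraph.maxDegree_le_of_forall_degree_le _ _ fun v => v.elim0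
  rw [if_pos hdeg, Fintype.sum_subsingleton _ (∅ : Finset (Fin 0))]
  simp

/-- The cylinder `10{0,1}*` is recognised by a 4-state DFA. [folklore] -/
theorem exists_dfa_junkCylinder :
    ∃ M : DFA Bool (Fin 4), ∀ x, M.eval x ∈ M.accept ↔ ∃ w, x = true :: false :: w := by
  let M : DFA Bool (Fin 4) :=
    { step := fun s a => if s = 0 then (if a then 1 else 3) else if s = 1 then (if a then 3 else 2)
        else s
      start := 0
      accept := {s | s = 2} }
  have hstay : ∀ (w : List Bool) (s : Fin 4), s ≠ 0 → s ≠ 1 → M.evalFrom s w = s := by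
    intro w
    induction w with
    | nil => intro s _ _; rfl
    | cons a w ih =>
      intro s h0 h1
      rw [DFA.evalFrom_cons]
      have : M.step s a = s := by simp [M, h0, h1]
      rw [this]
      exact ih s h0 h1
  refine ⟨M, fun x => ?_⟩
  constructor
  · intro hx
    match x, hx with
    | [], hx => exact absurd hx (by simp [M, DFA.eval])
    | [a], hx =>
      exfalso
      cases a <;> simp [M, DFA.eval] at hx
    | a :: b :: w, hx =>
      cases a <;> cases b
      · exfalso
        have h3 : M.eval (false :: false :: w) = 3 := hstay w 3 (by decide) (by decide)
        rw [h3] at hx; exact absurd hx (by simp [M])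
      · exfalso
        have h3 : M.eval (false :: true :: w) = 3 := hstay w 3 (by decide) (by decide)
        rw [h3] at hx; exact absurd hx (by simp [M])
      · exact ⟨w, rfl⟩
      · exfalso
        have h3 : M.eval (true :: true :: w) = 3 := hstay w 3 (by decide) (by decide)
        rw [h3] at hx; exact absurd hx (by simp [M])
  · rintro ⟨w, rfl⟩
    have h2 : M.eval (true :: false :: w) = 2 := hstay w 2 (by decide) (by decide)
    rw [h2]
    simp [M]

open scoped Classical in
/-- THE NO-SAMPLER CANNOT HIDE IN THE JUNK. For every witness-shaped triple with the crux's
hard-core count `N`: although `10{0,1}* ⊆ {0 < N ≤ t n}` eventually (`hardcoreCount_junk`; `t n ≥ 1`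
eventually because `{0 < N ≤ 0} = ∅`), the cylinder is disjoint from the YES-event
`{8 t n ≤ N}`, so `D₀ n (10{0,1}*) → 0`, and the 4-state DFA test (`dfa_merge`) transfers this to
`D₁`: `D₁ n (10{0,1}*) → 0`. Positivity alone does not force `D₁` onto genuine graph codes;
indistinguishability from `D₀` does. [this work] -/
theorem junk_mass_tendsto_zero (Δ p q : ℕ) (D₀ D₁ : Ensemble) (t : ℕ → ℕ)
    (hind : ∀ A : RandAlg (List Bool) Bool,
      A.IsPolyTime (id : List Bool → List Bool) Computability.encodeBool →
      Tendsto (fun n : ℕ => |(∑' x : List Bool, ((D₀ n) x).toReal * A.pr id x {b | b = true}) -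
        (∑' x : List Bool, ((D₁ n) x).toReal * A.pr id x {b | b = true})|) atTop (𝓝 0))
    (h₀ : Tendsto (fun n : ℕ => D₀.prob n {x | 8 * t n ≤ (match
        Literature.Computability.Complexity.encodingGraph.decode x with
        | none => 0
        | some G => if G.2.maxDegree ≤ Δ then ∑ I : Finset (Fin G.1),
            (if G.2.IsIndepSet (↑I : Set (Fin G.1)) then p ^ I.card * q ^ (G.1 - I.card) else 0)
          else 0)}) atTop (𝓝 1))
    (h₁ : Tendsto (fun n : ℕ => D₁.prob n {x | 0 < (match
        Literature.Computability.Complexity.encodingGraph.decode x with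
        | none => 0
        | some G => if G.2.maxDegree ≤ Δ then ∑ I : Finset (Fin G.1),
            (if G.2.IsIndepSet (↑I : Set (Fin G.1)) then p ^ I.card * q ^ (G.1 - I.card) else 0)
          else 0) ∧ (match Literature.Computability.Complexity.encodingGraph.decode x with
        | none => 0
        | some G => if G.2.maxDegree ≤ Δ then ∑ I : Finset (Fin G.1),
            (if G.2.IsIndepSet (↑I : Set (Fin G.1)) then p ^ I.card * q ^ (G.1 - I.card) else 0)
          else 0) ≤ t n}) atTop (𝓝 1)) :
    Tendsto (fun n => D₀.prob n {x | ∃ w, x = true :: false :: w}) atTop (𝓝 0) ∧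
      Tendsto (fun n => D₁.prob n {x | ∃ w, x = true :: false :: w}) atTop (𝓝 0) := by
  -- abbreviate the count
  set N : List Bool → ℕ := fun x => (match
        Literature.Computability.Complexity.encodingGraph.decode x with
        | none => 0
        | some G => if G.2.maxDegree ≤ Δ then ∑ I : Finset (Fin G.1),
            (if G.2.IsIndepSet (↑I : Set (Fin G.1)) then p ^ I.card * q ^ (G.1 - I.card) else 0)
          else 0) with hN
  have hjunk : ∀ w, N (true :: false :: w) = 1 := fun w => by
    simp only [hN]; exact hardcoreCount_junk Δ p q w
  -- eventually `t n ≥ 1`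
  have ht : ∀ᶠ n in atTop, 0 < t n := by
    have e := h₁.eventually_const_lt (show (1 / 2 : ℝ) < 1 by norm_num)
    refine e.mono fun n hn => ?_
    by_contra h0
    have ht0 : t n = 0 := by omega
    have hempty : {x | 0 < N x ∧ N x ≤ t n} = ∅ := by
      ext x; simp only [Set.mem_setOf_eq, Set.mem_empty_iff_false, iff_false]; omega
    have : D₁.prob n {x | 0 < N x ∧ N x ≤ t n} = 0 := by
      rw [hempty]; simp [Ensemble.prob]
    change (1 / 2 : ℝ) < D₁.prob n {x | 0 < N x ∧ N x ≤ t n} at hn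
    linarith
  -- the cylinder is eventually disjoint from the YES-event, so its D₀-mass vanishes
  set J : Set (List Bool) := {x | ∃ w, x = true :: false :: w} with hJ
  have hJU : ∀ᶠ n in atTop, D₀.prob n J ≤ 1 - D₀.prob n {x | 8 * t n ≤ N x} := by
    refine ht.mono fun n hn => ?_
    have hsub : J ⊆ {x | 8 * t n ≤ N x}ᶜ := by
      rintro x ⟨w, rfl⟩ (hx : 8 * t n ≤ N (true :: false :: w))
      rw [hjunk] at hx
      omega
    have h' := mass_mono (D₀ n) hsub
    have hc := mass_add_compl (D₀ n) {x | 8 * t n ≤ N x}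
    change mass (D₀ n) J ≤ 1 - mass (D₀ n) {x | 8 * t n ≤ N x}
    linarith
  have hD₀ : Tendsto (fun n => D₀.prob n J) atTop (𝓝 0) := by
    have hup : Tendsto (fun n => 1 - D₀.prob n {x | 8 * t n ≤ N x}) atTop (𝓝 0) := by
      simpa using (tendsto_const_nhds (x := (1 : ℝ))).sub h₀
    refine tendsto_of_tendsto_of_tendsto_of_le_of_le' tendsto_const_nhds hup
      (Eventually.of_forall fun n => Ensemble.prob_nonneg _ _ _) hJU
  -- transfer to D₁ by the DFA test
  obtain ⟨M, hM⟩ := exists_dfa_junkCylinder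
  have hset : {x | M.eval x ∈ M.accept} = J := Set.ext hM
  have hmerge := dfa_merge D₀ D₁ hind M
  rw [hset] at hmerge
  refine ⟨hD₀, ?_⟩
  have hsum : Tendsto (fun n => |D₀.prob n J - D₁.prob n J| + D₀.prob n J) atTop (𝓝 0) := by
    simpa using hmerge.add hD₀
  refine tendsto_of_tendsto_of_tendsto_of_le_of_le tendsto_const_nhds hsum
    (fun n => Ensemble.prob_nonneg _ _ _) (fun n => ?_)
  have := neg_abs_le (D₀.prob n J - D₁.prob n J)
  simp only at this ⊢
  linarith [abs_sub_comm (D₀.prob n J) (D₁.prob n J), le_abs_self (D₁.prob n J - D₀.prob n J)]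

/-! # Cycle 2, continued: setwise merging is merging in total variation (Phillips' lemma)

Content of the landed `Negative/SetwiseToTV.lean` (p76702), in the `mass` notation of this file. -/

variable {X : Type*}

/-- Additivity of mass on disjoint finite sets. [folklore] -/
theorem mass_finset_union (p : PMF X) {A B : Finset X} [DecidableEq X] (h : Disjoint A B) :
    mass p ↑(A ∪ B) =
      mass p ↑A + mass p ↑B := by
  rw [mass_finset, mass_finset, mass_finset, Finset.sum_union h]

/-- The signed discrepancy of a sub-finset is at most the pointwise discrepancy of the finset.
[folklore] -/
theorem sub_le_pointwise (p q : PMF X) {A Φ : Finset X} (h : A ⊆ Φ) :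
    mass p ↑A - mass q ↑A ≤
      ∑ x ∈ Φ, |mass p {x} - mass q {x}| := by
  rw [mass_finset, mass_finset, ← Finset.sum_sub_distrib]
  simp only [mass_singleton]
  calc ∑ x ∈ A, ((p x).toReal - (q x).toReal) ≤ ∑ x ∈ A, |(p x).toReal - (q x).toReal| :=
        Finset.sum_le_sum fun x _ => le_abs_self _
    _ ≤ ∑ x ∈ Φ, |(p x).toReal - (q x).toReal| :=
        Finset.sum_le_sum_of_subset_of_nonneg h fun _ _ _ => abs_nonneg _

/-- PHILLIPS' LEMMA (Schur property of `ℓ¹`) for probability mass functions: setwise merging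
`|P n (S) − Q n (S)| → 0` for every `S` is already UNIFORM in `S` (total variation `→ 0`).
Gliding hump. [folklore] -/
theorem setwise_merge_uniform (P Q : ℕ → PMF X)
    (h : ∀ S : Set X, Tendsto (fun n => |mass (P n) S -
      mass (Q n) S|) atTop (𝓝 0))
    {ε : ℝ} (hε : 0 < ε) :
    ∀ᶠ n in atTop, ∀ S : Set X,
      |mass (P n) S - mass (Q n) S| ≤ ε := by
  classical
  by_contra hcon
  simp only [not_eventually, not_forall, not_le] at hcon
  -- WLOG the discrepancy is positive (pass to the complement otherwise)
  have hfreq : ∃ᶠ n in atTop, ∃ S : Set X,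
      ε < mass (P n) S - mass (Q n) S := by
    refine hcon.mono fun n ⟨S, hS⟩ => ?_
    rcases le_or_gt 0 (mass (P n) S - mass (Q n) S)
      with hpos | hneg
    · exact ⟨S, by rwa [abs_of_nonneg hpos] at hS⟩
    · refine ⟨Sᶜ, ?_⟩
      rw [abs_of_neg hneg] at hS
      have h1 := mass_add_compl (P n) S
      have h2 := mass_add_compl (Q n) S
      linarith
  -- pointwise discrepancy on a finite set
  set d : ℕ → Finset X → ℝ := fun n Φ => ∑ x ∈ Φ, |mass (P n) {x} -
    mass (Q n) {x}| with hd
  have hd_tendsto : ∀ Φ : Finset X, Tendsto (fun n => d n Φ) atTop (𝓝 0) := by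
    intro Φ
    have h' := tendsto_finsetSum Φ (fun x (_ : x ∈ Φ) => h {x})
    simpa [hd] using h'
  set δ : ℝ := ε / 8 with hδ
  have hδpos : 0 < δ := by positivity
  -- good indices exist beyond any bound
  have hstep : ∀ (m : ℕ) (Φ : Finset X), ∃ n, m < n ∧ d n Φ ≤ δ ∧ ∃ S : Set X,
      ε < mass (P n) S - mass (Q n) S := by
    intro m Φ
    have e1 := (hd_tendsto Φ).eventually_lt_const hδpos
    obtain ⟨n, hnS, hnm, hnd⟩ := (hfreq.and_eventually ((eventually_gt_atTop m).and e1)).exists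
    exact ⟨n, hnm, hnd.le, hnS⟩
  -- two-sided tightness at every index
  have htight : ∀ n, ∃ E : Finset X, mass (P n) ((↑E)ᶜ) ≤ δ ∧
      mass (Q n) ((↑E)ᶜ) ≤ δ := by
    intro n
    obtain ⟨E₁, h₁⟩ := exists_finset_mass_compl_le (P n) hδpos
    obtain ⟨E₂, h₂⟩ := exists_finset_mass_compl_le (Q n) hδpos
    refine ⟨E₁ ∪ E₂, ?_, ?_⟩
    · refine (mass_mono _ (Set.compl_subset_compl.2 ?_)).trans h₁
      rw [Finset.coe_union]; exact Set.subset_union_left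
    · refine (mass_mono _ (Set.compl_subset_compl.2 ?_)).trans h₂
      rw [Finset.coe_union]; exact Set.subset_union_right
  -- the recursion: state = (last index, union of all finite sets used so far)
  let nOf : ℕ × Finset X → ℕ := fun s => Classical.choose (hstep s.1 s.2)
  have nOf_spec : ∀ s : ℕ × Finset X, s.1 < nOf s ∧ d (nOf s) s.2 ≤ δ ∧ ∃ S : Set X,
      ε < mass (P (nOf s)) S - mass (Q (nOf s)) S :=
    fun s => Classical.choose_spec (hstep s.1 s.2)
  let SOf : ℕ × Finset X → Set X := fun s => Classical.choose (nOf_spec s).2.2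
  have SOf_spec : ∀ s : ℕ × Finset X, ε < mass (P (nOf s)) (SOf s) -
      mass (Q (nOf s)) (SOf s) :=
    fun s => Classical.choose_spec (nOf_spec s).2.2
  let EOf : ℕ × Finset X → Finset X := fun s => Classical.choose (htight (nOf s))
  have EOf_spec : ∀ s : ℕ × Finset X,
      mass (P (nOf s)) ((↑(EOf s))ᶜ) ≤ δ ∧
        mass (Q (nOf s)) ((↑(EOf s))ᶜ) ≤ δ :=
    fun s => Classical.choose_spec (htight (nOf s))
  let st : ℕ → ℕ × Finset X := fun k => Nat.rec (0, ∅) (fun _ s => (nOf s, s.2 ∪ EOf s)) k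
  let nk : ℕ → ℕ := fun k => nOf (st k)
  let Φk : ℕ → Finset X := fun k => (st k).2
  let Ek : ℕ → Finset X := fun k => EOf (st k)
  let Sk : ℕ → Set X := fun k => SOf (st k)
  let Fk : ℕ → Finset X := fun k => ((Ek k).filter (fun x => x ∈ Sk k)) \ Φk k
  have Φ_succ : ∀ k, Φk (k + 1) = Φk k ∪ Ek k := fun k => rfl
  have nk_strictMono : StrictMono nk := by
    refine strictMono_nat_of_lt_succ fun k => ?_
    exact (nOf_spec (st (k + 1))).1
  have Φ_mono : Monotone Φk :=
    monotone_nat_of_le_succ fun k => by rw [Φ_succ]; exact Finset.subset_union_left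
  have E_sub_Φ : ∀ {j k : ℕ}, j < k → Ek j ⊆ Φk k := by
    intro j k hjk
    have h1 : Ek j ⊆ Φk (j + 1) := by rw [Φ_succ]; exact Finset.subset_union_right
    exact h1.trans (Φ_mono (Nat.succ_le_of_lt hjk))
  have F_sub_E : ∀ k, Fk k ⊆ Ek k := fun k => Finset.sdiff_subset.trans (Finset.filter_subset _ _)
  have F_sub_Sk : ∀ k, (↑(Fk k) : Set X) ⊆ Sk k := by
    intro k x hx
    have hx' := Finset.mem_sdiff.1 (Finset.mem_coe.1 hx)
    exact (Finset.mem_filter.1 hx'.1).2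
  have F_disj_Φ : ∀ k, Disjoint (Fk k) (Φk k) := fun k => Finset.sdiff_disjoint
  -- the single set
  let T : Set X := ⋃ k, (↑(Fk k) : Set X)
  have F_sub_T : ∀ k, (↑(Fk k) : Set X) ⊆ T := fun k =>
    Set.subset_iUnion (fun k => (↑(Fk k) : Set X)) k
  have T_sub : ∀ k, T ⊆ (↑(Fk k) ∪ ↑((Φk k).filter (fun x => x ∈ T))) ∪ (↑(Ek k))ᶜ := by
    intro k x hx
    obtain ⟨j, hj⟩ := Set.mem_iUnion.1 hx
    rcases lt_trichotomy j k with hjk | rfl | hkj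
    · exact Or.inl (Or.inr (Finset.mem_coe.2 (Finset.mem_filter.2
        ⟨E_sub_Φ hjk (F_sub_E j (Finset.mem_coe.1 hj)), hx⟩)))
    · exact Or.inl (Or.inl hj)
    · refine Or.inr fun hxE => ?_
      have hxΦ : x ∈ Φk j := E_sub_Φ hkj (Finset.mem_coe.1 hxE)
      exact Finset.disjoint_left.1 (F_disj_Φ j) (Finset.mem_coe.1 hj) hxΦ
  -- discrepancy estimates at stage k
  have hgap : ∀ k, ε / 2 ≤ mass (P (nk k)) T -
      mass (Q (nk k)) T := by
    intro k
    have hdΦ : d (nk k) (Φk k) ≤ δ := (nOf_spec (st k)).2.1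
    have hS : ε < mass (P (nk k)) (Sk k) -
        mass (Q (nk k)) (Sk k) := SOf_spec (st k)
    have hPE : mass (P (nk k)) ((↑(Ek k))ᶜ) ≤ δ := (EOf_spec (st k)).1
    have hQE : mass (Q (nk k)) ((↑(Ek k))ᶜ) ≤ δ := (EOf_spec (st k)).2
    -- the hump carries discrepancy ≥ ε − 2δ
    set ΦS : Finset X := (Φk k).filter (fun x => x ∈ Sk k) with hΦS
    have hΦS_sub : ΦS ⊆ Φk k := Finset.filter_subset _ _
    have hF_disj_ΦS : Disjoint (Fk k) ΦS := (F_disj_Φ k).mono_right hΦS_sub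
    have hSk_sub : Sk k ⊆ (↑(Fk k) ∪ ↑ΦS) ∪ (↑(Ek k))ᶜ := by
      intro x hxS
      by_cases hxE : x ∈ Ek k
      · by_cases hxΦ : x ∈ Φk k
        · exact Or.inl (Or.inr (Finset.mem_coe.2 (Finset.mem_filter.2 ⟨hxΦ, hxS⟩)))
        · exact Or.inl (Or.inl (Finset.mem_coe.2
            (Finset.mem_sdiff.2 ⟨Finset.mem_filter.2 ⟨hxE, hxS⟩, hxΦ⟩)))
      · exact Or.inr fun h' => hxE (Finset.mem_coe.1 h')
    have hunion_sub_S : (↑(Fk k ∪ ΦS) : Set X) ⊆ Sk k := by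
      rw [Finset.coe_union]
      exact Set.union_subset (F_sub_Sk k) fun x hx => (Finset.mem_filter.1 (Finset.mem_coe.1 hx)).2
    have hPS : mass (P (nk k)) (Sk k) ≤
        mass (P (nk k)) ↑(Fk k) + mass (P (nk k)) ↑ΦS
          + mass (P (nk k)) ((↑(Ek k))ᶜ) := by
      calc mass (P (nk k)) (Sk k)
          ≤ mass (P (nk k)) ((↑(Fk k) ∪ ↑ΦS) ∪ (↑(Ek k))ᶜ) :=
            mass_mono _ hSk_sub
        _ ≤ mass (P (nk k)) (↑(Fk k) ∪ ↑ΦS) +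
            mass (P (nk k)) ((↑(Ek k))ᶜ) := mass_union_le _ _ _
        _ ≤ _ := by
            have h'' := mass_union_le (P (nk k)) ↑(Fk k) ↑ΦS
            linarith
    have hQS : mass (Q (nk k)) ↑(Fk k) +
        mass (Q (nk k)) ↑ΦS ≤ mass (Q (nk k)) (Sk k) := by
      rw [← mass_finset_union (Q (nk k)) hF_disj_ΦS]
      exact mass_mono _ hunion_sub_S
    have hΦS_d : mass (P (nk k)) ↑ΦS -
        mass (Q (nk k)) ↑ΦS ≤ δ :=
      (sub_le_pointwise (P (nk k)) (Q (nk k)) hΦS_sub).trans hdΦ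
    have hhump : ε - 2 * δ ≤ mass (P (nk k)) ↑(Fk k) -
        mass (Q (nk k)) ↑(Fk k) := by
      linarith
    -- the set T at stage k
    set ΦT : Finset X := (Φk k).filter (fun x => x ∈ T) with hΦT
    have hΦT_sub : ΦT ⊆ Φk k := Finset.filter_subset _ _
    have hF_disj_ΦT : Disjoint (Fk k) ΦT := (F_disj_Φ k).mono_right hΦT_sub
    have hunion_sub_T : (↑(Fk k ∪ ΦT) : Set X) ⊆ T := by
      rw [Finset.coe_union]
      exact Set.union_subset (F_sub_T k) fun x hx => (Finset.mem_filter.1 (Finset.mem_coe.1 hx)).2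
    have hQT : mass (Q (nk k)) T ≤
        mass (Q (nk k)) ↑(Fk k) + mass (Q (nk k)) ↑ΦT
          + mass (Q (nk k)) ((↑(Ek k))ᶜ) := by
      calc mass (Q (nk k)) T
          ≤ mass (Q (nk k)) ((↑(Fk k) ∪ ↑ΦT) ∪ (↑(Ek k))ᶜ) :=
            mass_mono _ (T_sub k)
        _ ≤ mass (Q (nk k)) (↑(Fk k) ∪ ↑ΦT) +
            mass (Q (nk k)) ((↑(Ek k))ᶜ) := mass_union_le _ _ _
        _ ≤ _ := by
            have h'' := mass_union_le (Q (nk k)) ↑(Fk k) ↑ΦT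
            linarith
    have hPT : mass (P (nk k)) ↑(Fk k) +
        mass (P (nk k)) ↑ΦT ≤ mass (P (nk k)) T := by
      rw [← mass_finset_union (P (nk k)) hF_disj_ΦT]
      exact mass_mono _ hunion_sub_T
    have hΦT_d : mass (Q (nk k)) ↑ΦT -
        mass (P (nk k)) ↑ΦT ≤ δ := by
      have h' := sub_le_pointwise (Q (nk k)) (P (nk k)) hΦT_sub
      have hd' : ∑ x ∈ Φk k, |mass (Q (nk k)) {x} -
          mass (P (nk k)) {x}| = d (nk k) (Φk k) := by
        simp only [hd]
        exact Finset.sum_congr rfl fun x _ => abs_sub_comm _ _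
      linarith
    have hδε : δ = ε / 8 := hδ
    linarith
  -- contradiction with the hypothesis on T along the subsequence nk
  have hlim : Tendsto (fun k => |mass (P (nk k)) T -
      mass (Q (nk k)) T|) atTop (𝓝 0) :=
    (h T).comp nk_strictMono.tendsto_atTop
  obtain ⟨k, hk⟩ := (hlim.eventually_lt_const (show (0 : ℝ) < ε / 2 by positivity)).exists
  have := hgap k
  linarith [le_abs_self (mass (P (nk k)) T -
    mass (Q (nk k)) T)]

/-- CLAUSE (i) WITHOUT THE TIME BOUND IS STATISTICAL INDISTINGUISHABILITY. If every
`RandAlg (List Bool) Bool` (index-free, computationally unbounded) has vanishing advantage, then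
`sup_S |D₀ n (S) − D₁ n (S)| → 0`: the deterministic indicator tests give setwise merging
(`tsum_indicatorTest_eq_mass`), and Phillips' lemma makes it uniform. So the index-free
unbounded test class loses nothing against the index-fed one at the information-theoretic level;
all content of the crux sits in the time bound (cf. `pseudorandomTwinsAbove_false_without_polyTime`).
[this work] -/
theorem tv_merge_of_unbounded_tests (D₀ D₁ : Ensemble)
    (hind : ∀ A : RandAlg (List Bool) Bool, Tendsto (fun n : ℕ =>
      |(∑' x : List Bool, ((D₀ n) x).toReal * A.pr id x {b | b = true}) -
        (∑' x : List Bool, ((D₁ n) x).toReal * A.pr id x {b | b = true})|) atTop (𝓝 0))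
    {ε : ℝ} (hε : 0 < ε) :
    ∀ᶠ n in atTop, ∀ S : Set (List Bool), |D₀.prob n S - D₁.prob n S| ≤ ε := by
  classical
  refine setwise_merge_uniform D₀ D₁ (fun S => ?_) hε
  have h' := hind (RandAlg.ofDet fun x => decide (x ∈ S))
  simp only [tsum_indicatorTest_eq_mass] at h'
  exact h'

/-- FOR THE TYPED CRUX THE LENGTH LAWS MERGE IN TOTAL VARIATION: for every witness pair and
every `ε > 0`, eventually `|D₀ n (|x| ∈ T) − D₁ n (|x| ∈ T)| ≤ ε` for ALL `T ⊆ ℕ` simultaneously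
(`lengthSet_merge` + Phillips' lemma on the push-forwards to `ℕ`). [this work] -/
theorem lengthLaws_tv_merge (D₀ D₁ : Ensemble)
    (hind : ∀ A : RandAlg (List Bool) Bool,
      A.IsPolyTime (id : List Bool → List Bool) Computability.encodeBool →
      Tendsto (fun n : ℕ => |(∑' x : List Bool, ((D₀ n) x).toReal * A.pr id x {b | b = true}) -
        (∑' x : List Bool, ((D₁ n) x).toReal * A.pr id x {b | b = true})|) atTop (𝓝 0))
    {ε : ℝ} (hε : 0 < ε) :
    ∀ᶠ n in atTop, ∀ T : Set ℕ,
      |D₀.prob n {x | x.length ∈ T} - D₁.prob n {x | x.length ∈ T}| ≤ ε := by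
  have hmap : ∀ (D : PMF (List Bool)) (S : Set ℕ),
      mass (D.map List.length) S =
        mass D {x | x.length ∈ S} := by
    intro D S
    unfold mass
    rw [PMF.toOuterMeasure_map_apply]
    rfl
  have h := setwise_merge_uniform (fun n => (D₀ n).map List.length)
    (fun n => (D₁ n).map List.length) (fun S => ?_) hε
  · simp only [hmap] at h
    exact h
  · simp only [hmap]
    exact lengthSet_merge D₀ D₁ hind S

/-! # Cycle 2, continued: vertex counts and thresholds escape; summary `witness_constraints`

Content of `Negative/VertexEscape.lean` (p77007), in the `mass` notation of this file. -/

/-! ## Arithmetic of the code -/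

/-- `decodePosNum` dominates the length of its input. [folklore] -/
theorem length_le_decodePosNum : ∀ l : List Bool, l.length ≤ (Computability.decodePosNum l : ℕ)
  | [] => by simp
  | false :: l => by
    have ih := length_le_decodePosNum l
    have hpos := PosNum.to_nat_pos (Computability.decodePosNum l)
    simp only [Computability.decodePosNum, PosNum.cast_bit0, List.length_cons]
    omega
  | true :: l => by
    have ih := length_le_decodePosNum l
    have hpos := PosNum.to_nat_pos (Computability.decodePosNum l)
    simp only [Computability.decodePosNum, List.length_cons]
    split_ifs with h
    · subst h; simp
    · simp only [PosNum.cast_bit1]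
      omega

/-- `|u| ≤ decodeNat u` (binary with the least significant bit first, the empty tail standing
for the leading `1`). [folklore] -/
theorem length_le_decodeNat (u : List Bool) : u.length ≤ Computability.decodeNat u := by
  unfold Computability.decodeNat Computability.decodeNum
  split_ifs with h
  · subst h; simp
  · simpa using length_le_decodePosNum u

/-- `decodeNat u = 0` only for `u = []`. [folklore] -/
theorem eq_nil_of_decodeNat_eq_zero (u : List Bool) (h : Computability.decodeNat u = 0) :
    u = [] := by
  by_contra hne
  have h1 := length_le_decodeNat u
  rw [h] at h1
  exact hne (List.eq_nil_of_length_eq_zero (Nat.le_zero.1 h1))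

/-- A pair string with NON-EMPTY second component is well formed: `|z| = 2|u| + 2 + |v|`.
[folklore] -/
theorem length_eq_of_boolUnpair_snd_ne_nil : ∀ z : List Bool, (boolUnpair z).2 ≠ [] →
    z.length = 2 * (boolUnpair z).1.length + 2 + (boolUnpair z).2.length
  | [], h => by simp [boolUnpair] at h
  | [b], h => by simp [boolUnpair] at h
  | b :: b' :: rest, h => by
    by_cases hb : b = b'
    · subst hb
      have h' : (boolUnpair rest).2 ≠ [] := by simpa [boolUnpair] using h
      have ih := length_eq_of_boolUnpair_snd_ne_nil rest h'
      simp only [boolUnpair, if_true, List.length_cons]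
      omega
    · cases b'
      · simp [boolUnpair, hb] at h
      · simp [boolUnpair, hb]; omega

/-- The strings that unpair to `([], [])`: length `≤ 1`, the junk cylinder `10{0,1}*`, or `01`.
[folklore] -/
theorem boolUnpair_eq_nil_nil : ∀ z : List Bool, boolUnpair z = ([], []) →
    z.length ≤ 2 ∨ ∃ w, z = true :: false :: w
  | [], _ => by simp
  | [b], _ => by simp
  | b :: b' :: rest, h => by
    by_cases hb : b = b'
    · subst hb
      simp [boolUnpair] at h
    · cases b'
      · cases b
        · exact absurd rfl hb
        · exact Or.inr ⟨rest, rfl⟩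
      · cases b
        · simp only [boolUnpair, Bool.false_eq_true, if_false, if_true, Prod.mk.injEq,
            true_and] at h
          subst h; simp
        · exact absurd rfl hb

/-- What a successful decoding says about the string: the first component decodes to the vertex
count `n` and the payload has exactly `n²` bits. [folklore] -/
theorem decode_eq_some {z : List Bool} {G : Σ n, SimpleGraph (Fin n)}
    (h : Literature.Computability.Complexity.encodingGraph.decode z = some G) :
    Computability.decodeNat (boolUnpair z).1 = G.1 ∧ (boolUnpair z).2.length = G.1 * G.1 := by
  simp only [Literature.Computability.Complexity.encodingGraph, Computability.Encoding.sigmaBool,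
    sigmaBoolDecode, Option.map_eq_some_iff] at h
  obtain ⟨G', hG', rfl⟩ := h
  refine ⟨rfl, ?_⟩
  simp only [encodingGraphFin, encodingBitVec, Option.map_eq_some_iff] at hG'
  obtain ⟨f, hf, -⟩ := hG'
  by_contra hlen
  rw [dif_neg hlen] at hf
  simp at hf

/-- FINITELY MANY STRINGS DECODE TO A GRAPH ON `1 ≤ n ≤ M` VERTICES: such a string is a well-formed
pair of total length `2|u| + 2 + n² ≤ 2M + 2 + M²`. [this work] -/
theorem fewVertexCodes_finite (M : ℕ) :
    {z : List Bool | ∃ G : Σ n, SimpleGraph (Fin n),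
      Literature.Computability.Complexity.encodingGraph.decode z = some G ∧ 1 ≤ G.1 ∧ G.1 ≤ M}.Finite := by
  refine (List.finite_length_le Bool (2 * M + 2 + M * M)).subset ?_
  rintro z ⟨G, hG, h1, hM⟩
  obtain ⟨hu, hv⟩ := decode_eq_some hG
  have hv' : (boolUnpair z).2 ≠ [] := by
    intro h
    rw [h, List.length_nil] at hv
    have : 1 ≤ G.1 * G.1 := Nat.one_le_iff_ne_zero.2 (Nat.mul_ne_zero (by omega) (by omega))
    omega
  have hz := length_eq_of_boolUnpair_snd_ne_nil z hv'
  have hul : (boolUnpair z).1.length ≤ G.1 := hu ▸ length_le_decodeNat _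
  have hmm : G.1 * G.1 ≤ M * M := Nat.mul_le_mul hM hM
  change z.length ≤ 2 * M + 2 + M * M
  omega

/-- THE `0`-VERTEX CODES ARE JUNK OR TINY: a string decoding to a graph on `Fin 0` unpairs to
`([], [])`, hence has length `≤ 2` or lies in the cylinder `10{0,1}*`. [this work] -/
theorem zeroVertexCodes_subset :
    {z : List Bool | ∃ G : Σ n, SimpleGraph (Fin n),
      Literature.Computability.Complexity.encodingGraph.decode z = some G ∧ G.1 = 0} ⊆
      {z | z.length ≤ 2} ∪ {z | ∃ w, z = true :: false :: w} := by
  rintro z ⟨G, hG, h0⟩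
  obtain ⟨hu, hv⟩ := decode_eq_some hG
  rw [h0] at hu hv
  have hu' := eq_nil_of_decodeNat_eq_zero _ hu
  have hv' : (boolUnpair z).2 = [] := List.eq_nil_of_length_eq_zero (by simpa using hv)
  have hpair : boolUnpair z = ([], []) := Prod.ext hu' hv'
  exact boolUnpair_eq_nil_nil z hpair

open scoped Classical in
/-- A VALID CODE ON `n` VERTICES HAS HARD-CORE COUNT AT LEAST `n` (for `p, q ≥ 1`): the `n`
singletons are independent sets, each contributing `p · q^{n-1} ≥ 1`. [folklore] -/
theorem vertexCount_le_hardcoreSum {p q : ℕ} (hp : 0 < p) (hq : 0 < q) {n : ℕ}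
    (G : SimpleGraph (Fin n)) :
    n ≤ ∑ I : Finset (Fin n),
      (if G.IsIndepSet (↑I : Set (Fin n)) then p ^ I.card * q ^ (n - I.card) else 0) := by
  set f : Finset (Fin n) → ℕ := fun I =>
    if G.IsIndepSet (↑I : Set (Fin n)) then p ^ I.card * q ^ (n - I.card) else 0 with hf
  have hsingle : ∀ v : Fin n, 1 ≤ f {v} := by
    intro v
    have hind : G.IsIndepSet (↑({v} : Finset (Fin n)) : Set (Fin n)) := by
      rw [Finset.coe_singleton]
      exact Set.pairwise_singleton v _
    simp only [hf, if_pos hind, Finset.card_singleton]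
    exact Nat.mul_pos (pow_pos hp _) (pow_pos hq _)
  calc n = ∑ _v : Fin n, 1 := by simp
    _ ≤ ∑ v : Fin n, f {v} := Finset.sum_le_sum fun v _ => hsingle v
    _ = ∑ I ∈ (Finset.univ : Finset (Fin n)).map ⟨({·} : Fin n → Finset (Fin n)),
          Finset.singleton_injective⟩, f I := by
        rw [Finset.sum_map]; rfl
    _ ≤ ∑ I, f I := Finset.sum_le_sum_of_subset (Finset.subset_univ _)

/-- The crux's guard forces `0 < p`: `λ_c(Δ) = (Δ-1)^{Δ-1}/(Δ-2)^Δ > 0` for `Δ ≥ 3`, so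
`p/q > 0`. [folklore] -/
theorem guard_pos {Δ p q : ℕ} (hΔ : 3 ≤ Δ)
    (hlam : ((Δ : ℝ) - 1) ^ (Δ - 1) / ((Δ : ℝ) - 2) ^ Δ < (p : ℝ) / q) : 0 < p := by
  have hΔ' : (3 : ℝ) ≤ Δ := by exact_mod_cast hΔ
  have h1 : (0 : ℝ) < ((Δ : ℝ) - 1) ^ (Δ - 1) := pow_pos (by linarith) _
  have h2 : (0 : ℝ) < ((Δ : ℝ) - 2) ^ Δ := pow_pos (by linarith) _
  have hpos : (0 : ℝ) < (p : ℝ) / q := (div_pos h1 h2).trans hlam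
  by_contra hp
  have hp0 : p = 0 := by omega
  subst hp0
  simp at hpos

/-! ## Consequences for witnesses: vertex counts and thresholds escape -/

open scoped Classical in
/-- VERTEX COUNTS ESCAPE TO INFINITY ON BOTH SIDES. For every witness-shaped triple with the
crux's `N` and every `M`, the event "the sample decodes to a graph on `≤ M` vertices" has vanishing
mass under `D₀ n` AND `D₁ n`: the `0`-vertex part is junk-or-tiny (`zeroVertexCodes_subset`,
`junk_mass_tendsto_zero`, `finset_mass_tendsto_zero`), the `1 ≤ n ≤ M` part is a finite set
(`fewVertexCodes_finite`). The typed (index-free) clause (i) allows tiny instances, but they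
must grow without bound. [this work] -/
theorem vertexCount_escapes (Δ p q : ℕ) (D₀ D₁ : Ensemble) (t : ℕ → ℕ)
    (hind : ∀ A : RandAlg (List Bool) Bool,
      A.IsPolyTime (id : List Bool → List Bool) Computability.encodeBool →
      Tendsto (fun n : ℕ => |(∑' x : List Bool, ((D₀ n) x).toReal * A.pr id x {b | b = true}) -
        (∑' x : List Bool, ((D₁ n) x).toReal * A.pr id x {b | b = true})|) atTop (𝓝 0))
    (h₀ : Tendsto (fun n : ℕ => D₀.prob n {x | 8 * t n ≤ (match
        Literature.Computability.Complexity.encodingGraph.decode x with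
        | none => 0
        | some G => if G.2.maxDegree ≤ Δ then ∑ I : Finset (Fin G.1),
            (if G.2.IsIndepSet (↑I : Set (Fin G.1)) then p ^ I.card * q ^ (G.1 - I.card) else 0)
          else 0)}) atTop (𝓝 1))
    (h₁ : Tendsto (fun n : ℕ => D₁.prob n {x | 0 < (match
        Literature.Computability.Complexity.encodingGraph.decode x with
        | none => 0
        | some G => if G.2.maxDegree ≤ Δ then ∑ I : Finset (Fin G.1),
            (if G.2.IsIndepSet (↑I : Set (Fin G.1)) then p ^ I.card * q ^ (G.1 - I.card) else 0)
          else 0) ∧ (match Literature.Computability.Complexity.encodingGraph.decode x with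
        | none => 0
        | some G => if G.2.maxDegree ≤ Δ then ∑ I : Finset (Fin G.1),
            (if G.2.IsIndepSet (↑I : Set (Fin G.1)) then p ^ I.card * q ^ (G.1 - I.card) else 0)
          else 0) ≤ t n}) atTop (𝓝 1)) (M : ℕ) :
    Tendsto (fun n => D₀.prob n {z | ∃ G : Σ n, SimpleGraph (Fin n),
        Literature.Computability.Complexity.encodingGraph.decode z = some G ∧ G.1 ≤ M}) atTop (𝓝 0) ∧
      Tendsto (fun n => D₁.prob n {z | ∃ G : Σ n, SimpleGraph (Fin n),
        Literature.Computability.Complexity.encodingGraph.decode z = some G ∧ G.1 ≤ M}) atTop (𝓝 0) := by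
  set N : List Bool → ℕ := fun x => (match
        Literature.Computability.Complexity.encodingGraph.decode x with
        | none => 0
        | some G => if G.2.maxDegree ≤ Δ then ∑ I : Finset (Fin G.1),
            (if G.2.IsIndepSet (↑I : Set (Fin G.1)) then p ^ I.card * q ^ (G.1 - I.card) else 0)
          else 0) with hN
  -- the three pieces
  set S : Set (List Bool) := {z | ∃ G : Σ n, SimpleGraph (Fin n),
    Literature.Computability.Complexity.encodingGraph.decode z = some G ∧ G.1 ≤ M} with hS
  set T₂ : Set (List Bool) := {z | z.length ≤ 2} with hT₂
  set J : Set (List Bool) := {z | ∃ w, z = true :: false :: w} with hJ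
  set F : Set (List Bool) := {z | ∃ G : Σ n, SimpleGraph (Fin n),
    Literature.Computability.Complexity.encodingGraph.decode z = some G ∧ 1 ≤ G.1 ∧ G.1 ≤ M} with hF
  have hsub : S ⊆ (T₂ ∪ J) ∪ F := by
    rintro z ⟨G, hG, hM⟩
    by_cases h0 : G.1 = 0
    · exact Or.inl (zeroVertexCodes_subset ⟨G, hG, h0⟩)
    · exact Or.inr ⟨G, hG, by omega, hM⟩
  -- disjointness of the two events of clause (ii)
  have hUV : ∀ n, Disjoint {x | 8 * t n ≤ N x} {x | 0 < N x ∧ N x ≤ t n} := by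
    intro n
    rw [Set.disjoint_left]
    rintro x (hx : 8 * t n ≤ N x) ⟨hpos, hle⟩
    omega
  have hT : Tendsto (fun n => D₀.prob n T₂) atTop (𝓝 0) ∧ Tendsto (fun n => D₁.prob n T₂) atTop (𝓝 0) :=
    shortStrings_mass_tendsto_zero D₀ D₁ hind _ _ hUV h₀ h₁ 2
  have hJm : Tendsto (fun n => D₀.prob n J) atTop (𝓝 0) ∧ Tendsto (fun n => D₁.prob n J) atTop (𝓝 0) :=
    junk_mass_tendsto_zero Δ p q D₀ D₁ t hind h₀ h₁
  have hFm : Tendsto (fun n => D₀.prob n F) atTop (𝓝 0) ∧ Tendsto (fun n => D₁.prob n F) atTop (𝓝 0) := by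
    have h := finset_mass_tendsto_zero D₀ D₁ hind _ _ hUV h₀ h₁ (fewVertexCodes_finite M).toFinset
    simpa only [Set.Finite.coe_toFinset] using h
  -- union bound and squeeze, for an arbitrary PMF sequence
  have key : ∀ D : Ensemble, Tendsto (fun n => D.prob n T₂) atTop (𝓝 0) →
      Tendsto (fun n => D.prob n J) atTop (𝓝 0) → Tendsto (fun n => D.prob n F) atTop (𝓝 0) →
      Tendsto (fun n => D.prob n S) atTop (𝓝 0) := by
    intro D hT hJ hF
    have hup : Tendsto (fun n => D.prob n T₂ + D.prob n J + D.prob n F) atTop (𝓝 0) := by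
      simpa using (hT.add hJ).add hF
    refine tendsto_of_tendsto_of_tendsto_of_le_of_le tendsto_const_nhds hup
      (fun n => Ensemble.prob_nonneg _ _ _) (fun n => ?_)
    calc D.prob n S ≤ D.prob n ((T₂ ∪ J) ∪ F) := mass_mono (D n) hsub
      _ ≤ D.prob n (T₂ ∪ J) + D.prob n F := mass_union_le (D n) _ _
      _ ≤ D.prob n T₂ + D.prob n J + D.prob n F := by
          have := mass_union_le (D n) T₂ J
          change mass (D n) (T₂ ∪ J) + mass (D n) F ≤ mass (D n) T₂ + mass (D n) J + mass (D n) F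
          linarith
  exact ⟨key D₀ hT.1 hJm.1 hFm.1, key D₁ hT.2 hJm.2 hFm.2⟩

open scoped Classical in
/-- THE THRESHOLD SEQUENCE TENDS TO INFINITY. For every witness-shaped triple with the crux's `N`
and `p, q ≥ 1` (`guard_pos`): `t n → ∞`. If `t n ≤ C` frequently, the NO-event
`{0 < N ≤ t n}` would sit inside "decodes to a graph on `≤ C` vertices" (a valid code on `m`
vertices has `N ≥ m`, `vertexCount_le_hardcoreSum`; an invalid one has `N = 0`), an event of
vanishing `D₁`-mass by `vertexCount_escapes` — contradicting `D₁ n (NO-event) → 1`. [this work] -/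
theorem threshold_tendsto_atTop (Δ p q : ℕ) (hp : 0 < p) (hq : 0 < q) (D₀ D₁ : Ensemble)
    (t : ℕ → ℕ)
    (hind : ∀ A : RandAlg (List Bool) Bool,
      A.IsPolyTime (id : List Bool → List Bool) Computability.encodeBool →
      Tendsto (fun n : ℕ => |(∑' x : List Bool, ((D₀ n) x).toReal * A.pr id x {b | b = true}) -
        (∑' x : List Bool, ((D₁ n) x).toReal * A.pr id x {b | b = true})|) atTop (𝓝 0))
    (h₀ : Tendsto (fun n : ℕ => D₀.prob n {x | 8 * t n ≤ (match
        Literature.Computability.Complexity.encodingGraph.decode x with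
        | none => 0
        | some G => if G.2.maxDegree ≤ Δ then ∑ I : Finset (Fin G.1),
            (if G.2.IsIndepSet (↑I : Set (Fin G.1)) then p ^ I.card * q ^ (G.1 - I.card) else 0)
          else 0)}) atTop (𝓝 1))
    (h₁ : Tendsto (fun n : ℕ => D₁.prob n {x | 0 < (match
        Literature.Computability.Complexity.encodingGraph.decode x with
        | none => 0
        | some G => if G.2.maxDegree ≤ Δ then ∑ I : Finset (Fin G.1),
            (if G.2.IsIndepSet (↑I : Set (Fin G.1)) then p ^ I.card * q ^ (G.1 - I.card) else 0)
          else 0) ∧ (match Literature.Computability.Complexity.encodingGraph.decode x with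
        | none => 0
        | some G => if G.2.maxDegree ≤ Δ then ∑ I : Finset (Fin G.1),
            (if G.2.IsIndepSet (↑I : Set (Fin G.1)) then p ^ I.card * q ^ (G.1 - I.card) else 0)
          else 0) ≤ t n}) atTop (𝓝 1)) :
    Tendsto t atTop atTop := by
  set N : List Bool → ℕ := fun x => (match
        Literature.Computability.Complexity.encodingGraph.decode x with
        | none => 0
        | some G => if G.2.maxDegree ≤ Δ then ∑ I : Finset (Fin G.1),
            (if G.2.IsIndepSet (↑I : Set (Fin G.1)) then p ^ I.card * q ^ (G.1 - I.card) else 0)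
          else 0) with hN
  -- a string of positive count decodes to a graph on at most `N` vertices
  have hcount : ∀ x, 0 < N x → ∃ G : Σ n, SimpleGraph (Fin n),
      Literature.Computability.Complexity.encodingGraph.decode x = some G ∧ G.1 ≤ N x := by
    intro x hx
    rcases hdec : Literature.Computability.Complexity.encodingGraph.decode x with _ | G
    · exfalso
      simp only [hN, hdec] at hx
      exact lt_irrefl 0 hx
    · refine ⟨G, rfl, ?_⟩
      simp only [hN, hdec] at hx ⊢
      split_ifs at hx ⊢ with hdeg
      · exact vertexCount_le_hardcoreSum hp hq G.2
      · exact absurd hx (lt_irrefl 0)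
  rw [tendsto_atTop]
  intro C
  have hsmall := (vertexCount_escapes Δ p q D₀ D₁ t hind h₀ h₁ C).2
  have e1 := h₁.eventually_const_lt (show (1 / 2 : ℝ) < 1 by norm_num)
  have e2 := hsmall.eventually_lt_const (show (0 : ℝ) < 1 / 2 by norm_num)
  filter_upwards [e1, e2] with n hn1 hn2
  by_contra hC
  have hC' : t n < C := not_le.1 hC
  have hsub : {x | 0 < N x ∧ N x ≤ t n} ⊆ {z | ∃ G : Σ n, SimpleGraph (Fin n),
      Literature.Computability.Complexity.encodingGraph.decode z = some G ∧ G.1 ≤ C} := by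
    rintro x ⟨hpos, hle⟩
    obtain ⟨G, hG, hGN⟩ := hcount x hpos
    exact ⟨G, hG, by omega⟩
  have hmono := mass_mono (D₁ n) hsub
  change (1 / 2 : ℝ) < mass (D₁ n) {x | 0 < N x ∧ N x ≤ t n} at hn1
  change mass (D₁ n) _ < 1 / 2 at hn2
  linarith

open scoped Classical in
/-- SANITY LINK / SUMMARY: the hypotheses of the theorems of this cycle are literally the clauses
of the crux, so EVERY witness `(Δ, p, q, D₀, D₁, t)` of `PseudorandomTwinsAbove` has: `0 < p`;
thresholds `t n → ∞`; vanishing mass, on BOTH sides, of every finite set of strings, of the codes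
of graphs with boundedly many vertices, and of the junk cylinder `10{0,1}*`; asymptotically equal
mass of every regular language; and length laws merging in total variation. (Hypothesis = the
crux; the conclusion asserts no route statement.) [this work] -/
theorem witness_constraints (h : Summit.PneNP.PneNP.Theses.PhaseTwins.PseudorandomTwinsAbove) :
    ∃ (p q : ℕ) (D₀ D₁ : Ensemble) (t : ℕ → ℕ), 0 < p ∧ 0 < q ∧ Tendsto t atTop atTop ∧
      (∀ Φ : Finset (List Bool),
        Tendsto (fun n => D₀.prob n ↑Φ) atTop (𝓝 0) ∧ Tendsto (fun n => D₁.prob n ↑Φ) atTop (𝓝 0)) ∧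
      (∀ M : ℕ, Tendsto (fun n => D₀.prob n {z | ∃ G : Σ n, SimpleGraph (Fin n),
          Literature.Computability.Complexity.encodingGraph.decode z = some G ∧ G.1 ≤ M}) atTop (𝓝 0) ∧
        Tendsto (fun n => D₁.prob n {z | ∃ G : Σ n, SimpleGraph (Fin n),
          Literature.Computability.Complexity.encodingGraph.decode z = some G ∧ G.1 ≤ M}) atTop (𝓝 0)) ∧
      (Tendsto (fun n => D₀.prob n {x | ∃ w, x = true :: false :: w}) atTop (𝓝 0) ∧
        Tendsto (fun n => D₁.prob n {x | ∃ w, x = true :: false :: w}) atTop (𝓝 0)) ∧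
      (∀ {σ : Type} [Fintype σ] (M : DFA Bool σ), Tendsto (fun n =>
        |D₀.prob n {x | M.eval x ∈ M.accept} - D₁.prob n {x | M.eval x ∈ M.accept}|) atTop (𝓝 0)) ∧
      (∀ ε : ℝ, 0 < ε → ∀ᶠ n in atTop, ∀ T : Set ℕ,
        |D₀.prob n {x | x.length ∈ T} - D₁.prob n {x | x.length ∈ T}| ≤ ε) := by
  obtain ⟨Δ, p, q, hΔ, hq, hlam, D₀, D₁, -, -, hind, t, h₀, h₁⟩ := h
  have hp := guard_pos hΔ hlam
  have hUV : ∀ n, Disjoint {x | 8 * t n ≤ (match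
        Literature.Computability.Complexity.encodingGraph.decode x with
        | none => 0
        | some G => if G.2.maxDegree ≤ Δ then ∑ I : Finset (Fin G.1),
            (if G.2.IsIndepSet (↑I : Set (Fin G.1)) then p ^ I.card * q ^ (G.1 - I.card) else 0)
          else 0)}
      {x | 0 < (match Literature.Computability.Complexity.encodingGraph.decode x with
        | none => 0
        | some G => if G.2.maxDegree ≤ Δ then ∑ I : Finset (Fin G.1),
            (if G.2.IsIndepSet (↑I : Set (Fin G.1)) then p ^ I.card * q ^ (G.1 - I.card) else 0)
          else 0) ∧ (match Literature.Computability.Complexity.encodingGraph.decode x with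
        | none => 0
        | some G => if G.2.maxDegree ≤ Δ then ∑ I : Finset (Fin G.1),
            (if G.2.IsIndepSet (↑I : Set (Fin G.1)) then p ^ I.card * q ^ (G.1 - I.card) else 0)
          else 0) ≤ t n} := by
    intro n
    rw [Set.disjoint_left]
    rintro x (hx : 8 * t n ≤ _) ⟨hpos, hle⟩
    omega
  exact ⟨p, q, D₀, D₁, t, hp, hq, threshold_tendsto_atTop Δ p q hp hq D₀ D₁ t hind h₀ h₁,
    finset_mass_tendsto_zero D₀ D₁ hind _ _ hUV h₀ h₁,
    vertexCount_escapes Δ p q D₀ D₁ t hind h₀ h₁, junk_mass_tendsto_zero Δ p q D₀ D₁ t hind h₀ h₁,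
    fun M => dfa_merge D₀ D₁ hind M, fun ε hε => lengthLaws_tv_merge D₀ D₁ hind hε⟩

end

/-! # Cycle 3 (2026-08-16): `-- Targets` — the picked line `prg-image-exact-threshold-lift`

The lead's skeleton `Lines/prg-image-exact-threshold-lift.lean` proves
`OWFExist → PseudorandomTwinsAbove` modulo six stubs (S1 `stub_prgImageTwins` — landed p76829 —,
S2a `stub_gapE3SATB`, S2b `stub_dupPad`, S4a `stub_conflictGraphFn`, S4b `stub_conflictGraphGap`,
S5 `stub_clauseI`). No stub is stuck (payload `stuck_stubs = []`), none is false as stated (audit in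
the module docstring, "Findings (cycle 3)"). What IS false are three natural weakenings, recorded
here as kernel-checked tightness results so that nobody simplifies the stubs in that direction:
`not_conflictGraphGapWithoutNodup` (S4b needs three DISTINCT variables per clause),
`not_conflictGraphGapWithoutOccurrenceBound` (S4b needs the occurrence bound) and
`not_dupPadWithPlainBound` (S2b needs `max B 1`). Content of `Negative/TargetsTight.lean` +
`Negative/TargetsOccurrence.lean`. -/

section Targets

open Literature.Probability.LatticeModels
open Finset

/-! ## The conflict graph of the line (verbatim the `fromRel` term of stubs S4a/S4b) -/

/-- The CONFLICT GRAPH on the annotated literal occurrences `KarpClique.annot 0 φ` (clause number,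
variable numeral, polarity): occurrences are adjacent iff they lie in the same clause on
different variables, or carry the same variable with opposite polarities — verbatim the
`SimpleGraph.fromRel` term of the lead's stubs `stub_conflictGraphFn` / `stub_conflictGraphGap`.
[folklore] -/
abbrev conflictGraph (φ : CNF ℕ) : SimpleGraph (Fin (KarpClique.annot 0 φ).length) :=
  SimpleGraph.fromRel fun p q : Fin (KarpClique.annot 0 φ).length =>
    ((KarpClique.annot 0 φ)[p].1 = (KarpClique.annot 0 φ)[q].1 ∧
        (KarpClique.annot 0 φ)[p].2.1 ≠ (KarpClique.annot 0 φ)[q].2.1) ∨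
    ((KarpClique.annot 0 φ)[p].2.1 = (KarpClique.annot 0 φ)[q].2.1 ∧
        (KarpClique.annot 0 φ)[p].2.2 ≠ (KarpClique.annot 0 φ)[q].2.2)

/-! ## Generic counting lemmas (classical `if`, as in `hardcoreCount`) -/

/-- `maxDegree` through a computable degree bound, for an ARBITRARY decidability instance (the
counting function `hardcoreCount` states its promise with the classical one). [folklore] -/
theorem maxDegree_le_of_card_filter_le {n : ℕ} (G : SimpleGraph (Fin n)) [d : DecidableRel G.Adj]
    (k : ℕ) (h : ∀ v, (univ.filter fun w => G.Adj v w).card ≤ k) (inst : DecidableRel G.Adj) :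
    @SimpleGraph.maxDegree _ G _ inst ≤ k := by
  have hi : inst = d := Subsingleton.elim _ _
  subst hi
  refine SimpleGraph.maxDegree_le_of_forall_degree_le G k fun v => ?_
  rw [← SimpleGraph.card_neighborFinset_eq_degree]
  refine (card_le_card fun w hw => ?_).trans (h v)
  rw [SimpleGraph.mem_neighborFinset] at hw
  exact mem_filter.2 ⟨mem_univ _, hw⟩

open scoped Classical in
/-- If no `3`-set is independent, the hard-core sum is at most the weight of ALL sets of size
`≤ 2`: `Σ_{k ≤ 2} C(n,k) p^k q^{n-k}`. [folklore] -/
theorem sum_indep_le_of_no_triple {n : ℕ} (G : SimpleGraph (Fin n)) (p q : ℕ)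
    (hG : ∀ I : Finset (Fin n), 3 ≤ I.card → ¬ G.IsIndepSet (↑I : Set (Fin n)))
    (m : ℕ) (hm : n = m) :
    ∑ I : Finset (Fin n), (if G.IsIndepSet (↑I : Set (Fin n)) then p ^ I.card * q ^ (n - I.card) else 0)
      ≤ ∑ k ∈ range (m + 1), m.choose k * (if k ≤ 2 then p ^ k * q ^ (m - k) else 0) := by
  subst hm
  calc ∑ I : Finset (Fin n),
        (if G.IsIndepSet (↑I : Set (Fin n)) then p ^ I.card * q ^ (n - I.card) else 0)
      ≤ ∑ I : Finset (Fin n), (if I.card ≤ 2 then p ^ I.card * q ^ (n - I.card) else 0) := by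
        refine sum_le_sum fun I _ => ?_
        by_cases hc : I.card ≤ 2
        · rw [if_pos hc]
          split_ifs
          · exact le_rfl
          · exact Nat.zero_le _
        · rw [if_neg hc, if_neg (hG I (by omega))]
    _ = ∑ k ∈ range (n + 1), n.choose k * (if k ≤ 2 then p ^ k * q ^ (n - k) else 0) := by
        have h := Finset.sum_powerset_apply_card
          (fun k => if k ≤ 2 then p ^ k * q ^ (n - k) else 0) (x := (univ : Finset (Fin n)))
        rw [Finset.powerset_univ, card_univ, Fintype.card_fin] at h
        rw [h]
        simp only [smul_eq_mul]

open scoped Classical in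
/-- `∅`, the `n` singletons and two distinct independent pairs already give
`q^n + n·p·q^{n-1} + 2·p²·q^{n-2}`. [folklore] -/
theorem le_sum_indep_of_two_pairs {n : ℕ} (G : SimpleGraph (Fin n)) (p q : ℕ) (L R : Finset (Fin n))
    (hL : G.IsIndepSet (↑L : Set (Fin n))) (hR : G.IsIndepSet (↑R : Set (Fin n)))
    (hLc : L.card = 2) (hRc : R.card = 2) (hLR : L ≠ R) (m : ℕ) (hm : n = m) :
    q ^ m + m * (p * q ^ (m - 1)) + 2 * (p ^ 2 * q ^ (m - 2)) ≤
      ∑ I : Finset (Fin n),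
        (if G.IsIndepSet (↑I : Set (Fin n)) then p ^ I.card * q ^ (n - I.card) else 0) := by
  subst hm
  let S : Finset (Finset (Fin n)) :=
    univ.map ⟨fun v : Fin n => ({v} : Finset (Fin n)), Finset.singleton_injective⟩
  let T : Finset (Finset (Fin n)) := insert ∅ (insert L (insert R S))
  have hS : ∀ A ∈ S, A.card = 1 := by
    intro A hA
    obtain ⟨v, -, rfl⟩ := mem_map.1 hA
    rfl
  have hempty : (∅ : Finset (Fin n)) ∉ insert L (insert R S) := by
    simp only [mem_insert, not_or]
    refine ⟨fun h => ?_, fun h => ?_, fun h => ?_⟩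
    · have := congrArg Finset.card h; rw [hLc] at this; simp at this
    · have := congrArg Finset.card h; rw [hRc] at this; simp at this
    · have := hS _ h; simp at this
  have hLm : L ∉ insert R S := by
    simp only [mem_insert, not_or]
    refine ⟨hLR, fun h => ?_⟩
    have := hS _ h; omega
  have hRm : R ∉ S := fun h => by have := hS _ h; omega
  calc q ^ n + n * (p * q ^ (n - 1)) + 2 * (p ^ 2 * q ^ (n - 2))
      = ∑ I ∈ T, (if G.IsIndepSet (↑I : Set (Fin n)) then p ^ I.card * q ^ (n - I.card) else 0) := by
        rw [sum_insert hempty, sum_insert hLm, sum_insert hRm, sum_map]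
        have e1 : (if G.IsIndepSet (↑(∅ : Finset (Fin n)) : Set (Fin n)) then
            p ^ (∅ : Finset (Fin n)).card * q ^ (n - (∅ : Finset (Fin n)).card) else 0) = q ^ n := by
          rw [if_pos (by simp [SimpleGraph.isIndepSet_iff])]
          simp
        have e2 : (if G.IsIndepSet (↑L : Set (Fin n)) then p ^ L.card * q ^ (n - L.card) else 0)
            = p ^ 2 * q ^ (n - 2) := by rw [if_pos hL, hLc]
        have e3 : (if G.IsIndepSet (↑R : Set (Fin n)) then p ^ R.card * q ^ (n - R.card) else 0)
            = p ^ 2 * q ^ (n - 2) := by rw [if_pos hR, hRc]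
        have e4 : ∀ v : Fin n, (if G.IsIndepSet (↑({v} : Finset (Fin n)) : Set (Fin n)) then
            p ^ ({v} : Finset (Fin n)).card * q ^ (n - ({v} : Finset (Fin n)).card) else 0)
            = p * q ^ (n - 1) := by
          intro v
          rw [if_pos (by simp [SimpleGraph.isIndepSet_iff])]
          simp
        simp only [Function.Embedding.coeFn_mk, e1, e2, e3, e4, sum_const, card_univ,
          Fintype.card_fin, smul_eq_mul]
        ring
    _ ≤ _ := sum_le_sum_of_subset (subset_univ T)

/-! ## Two E3-shaped CNFs, one with repeated variables inside its clauses -/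

/-- YES witness: `(x₀ ∨ x₁ ∨ x₂) ∧ (x₃ ∨ x₄ ∨ x₅)` — a genuine E3-CNF; conflict graph `2K₃`.
[this work] -/
def φyes : CNF ℕ := [[(0, true), (1, true), (2, true)], [(3, true), (4, true), (5, true)]]

/-- NO witness: `(x₀ ∨ x₀ ∨ x₀) ∧ (¬x₀ ∨ ¬x₀ ∨ ¬x₀)` — clauses of LENGTH 3 whose variables repeat;
unsatisfiable, `val = 1/2`; conflict graph `K₃,₃` (equal literals inside a clause are NOT in
conflict, so each side is an independent triple). [this work] -/
def φno : CNF ℕ := [[(0, true), (0, true), (0, true)], [(0, false), (0, false), (0, false)]]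

/-- `φyes` has `6` literal occurrences. [this work] -/
theorem length_annot_φyes : (KarpClique.annot 0 φyes).length = 6 := rfl

/-- `φno` has `6` literal occurrences. [this work] -/
theorem length_annot_φno : (KarpClique.annot 0 φno).length = 6 := rfl

/-- Every clause of `φyes` has length `3`. [this work] -/
theorem φyes_width : ∀ c ∈ φyes, c.length = 3 := by decide

/-- Every clause of `φno` has length `3` (though only one variable). [this work] -/
theorem φno_width : ∀ c ∈ φno, c.length = 3 := by decide

/-- `φyes` is satisfiable (all-true). [this work] -/
theorem φyes_satisfiable : φyes.Satisfiable := ⟨fun _ => true, by decide⟩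

/-- `val(φno) ≤ 1/2`: every assignment satisfies exactly one of the two clauses. [this work] -/
theorem maxSatFraction_φno_le : φno.maxSatFraction ≤ 1 / 2 := by
  unfold CNF.maxSatFraction
  refine Finset.sup'_le _ _ fun τ _ => ?_
  generalize (fun x => if h : x ∈ CNF.vars φno then τ ⟨x, h⟩ else false) = σ
  cases h : σ 0 <;>
    simp [CNF.satisfiedFraction, CNF.numClauses, Clause.eval, Literal.eval, φno, h]

/-- In the conflict graph of `φyes` two distinct occurrences of the same clause are adjacent.
[this work] -/
theorem adj_φyes_of_sameClause : ∀ a b : Fin (KarpClique.annot 0 φyes).length, a ≠ b →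
    decide (a.val < 3) = decide (b.val < 3) → (conflictGraph φyes).Adj a b := by
  decide

/-- Degrees in the conflict graph of `φyes` are `≤ 2`. [this work] -/
theorem degree_φyes_le : ∀ v : Fin (KarpClique.annot 0 φyes).length,
    (univ.filter fun w => (conflictGraph φyes).Adj v w).card ≤ 2 := by
  decide

/-- Degrees in the conflict graph of `φno` are `≤ 3`. [this work] -/
theorem degree_φno_le : ∀ v : Fin (KarpClique.annot 0 φno).length,
    (univ.filter fun w => (conflictGraph φno).Adj v w).card ≤ 3 := by
  decide

/-- Hence no independent set of the conflict graph of `φyes` has three elements (pigeonhole on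
the two clauses). [this work] -/
theorem not_isIndepSet_φyes (I : Finset (Fin (KarpClique.annot 0 φyes).length)) (hI : 3 ≤ I.card) :
    ¬ (conflictGraph φyes).IsIndepSet (↑I : Set (Fin (KarpClique.annot 0 φyes).length)) := by
  intro hind
  have hc : (univ : Finset Bool).card < I.card := by
    rw [card_univ, Fintype.card_bool]; omega
  obtain ⟨a, ha, b, hb, hne, hab⟩ := exists_ne_map_eq_of_card_lt_of_maps_to hc
    (f := fun v : Fin (KarpClique.annot 0 φyes).length => decide (v.val < 3)) fun _ _ => mem_univ _
  exact hind (mem_coe.2 ha) (mem_coe.2 hb) hne (adj_φyes_of_sameClause a b hne hab)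

/-- The left pair `{0, 1}` of `K₃,₃` is independent in the conflict graph of `φno`. [this work] -/
theorem isIndepSet_φno_left : (conflictGraph φno).IsIndepSet
    ↑(univ.filter fun v : Fin (KarpClique.annot 0 φno).length => v.val < 2) := by
  decide

/-- The right pair `{3, 4}` of `K₃,₃` is independent in the conflict graph of `φno`. [this work] -/
theorem isIndepSet_φno_right : (conflictGraph φno).IsIndepSet
    ↑(univ.filter fun v : Fin (KarpClique.annot 0 φno).length => 3 ≤ v.val ∧ v.val < 5) := by
  decide

/-! ## The hard-core counts of the two codes -/

/-- UPPER BOUND for the YES code: only sets of size `≤ 2` can be independent in `2K₃`, so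
`N ≤ q⁶ + 6pq⁵ + 15p²q⁴`. [this work] -/
theorem hardcoreCount_φyes_le (Δ p q : ℕ) (hΔ : 3 ≤ Δ) :
    hardcoreCount Δ p q (encodingGraph.encode ⟨(KarpClique.annot 0 φyes).length, conflictGraph φyes⟩)
      ≤ q ^ 6 + 6 * (p * q ^ 5) + 15 * (p ^ 2 * q ^ 4) := by
  have hdeg := maxDegree_le_of_card_filter_le (conflictGraph φyes) 2 degree_φyes_le
    (Classical.decRel _)
  rw [hardcoreCount_encode_of_maxDegree_le Δ p q _ (hdeg.trans (by omega))]
  refine (sum_indep_le_of_no_triple (conflictGraph φyes) p q not_isIndepSet_φyes 6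
    length_annot_φyes).trans (le_of_eq ?_)
  simp [Finset.sum_range_succ, Nat.choose_two_right]

/-- LOWER BOUND for the NO code: `∅`, the six singletons and one pair inside each side of `K₃,₃`
are independent, so `N ≥ q⁶ + 6pq⁵ + 2p²q⁴`. [this work] -/
theorem le_hardcoreCount_φno (Δ p q : ℕ) (hΔ : 3 ≤ Δ) :
    q ^ 6 + 6 * (p * q ^ 5) + 2 * (p ^ 2 * q ^ 4) ≤
      hardcoreCount Δ p q (encodingGraph.encode ⟨(KarpClique.annot 0 φno).length, conflictGraph φno⟩) := by
  have hdeg := maxDegree_le_of_card_filter_le (conflictGraph φno) 3 degree_φno_le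
    (Classical.decRel _)
  rw [hardcoreCount_encode_of_maxDegree_le Δ p q _ (hdeg.trans hΔ)]
  have h := le_sum_indep_of_two_pairs (conflictGraph φno) p q _ _ isIndepSet_φno_left
    isIndepSet_φno_right (by decide) (by decide) (by decide) 6 length_annot_φno
  simpa using h

/-! ## The target `stub_conflictGraphGap` without `Nodup` is FALSE -/

/-- Stub S4b of the picked line with `φ.IsExactWidth 3` (every clause has 3 literals on 3 PAIRWISE
DISTINCT variables) weakened to "every clause has 3 literals" — variables may repeat inside a
clause. Verbatim otherwise. [this work] -/
def ConflictGraphGapWithoutNodup : Prop :=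
  ∀ (B : ℕ) (γ : ℚ), 0 < γ →
    ∃ (Δ p q : ℕ) (τ len : ℕ → ℕ), 3 ≤ Δ ∧ 0 < q ∧ hardCoreThreshold Δ < (p : ℝ) / q ∧ StrictMono len ∧
      ∀ φ : CNF ℕ, (∀ c ∈ φ, c.length = 3) → (∀ v : ℕ, (φ.countP fun cl => v ∈ cl.map Prod.fst) ≤ B) →
        0 < φ.length → ∀ x : List Bool,
        x = encodingGraph.encode ⟨(KarpClique.annot 0 φ).length,
          SimpleGraph.fromRel fun p q : Fin (KarpClique.annot 0 φ).length =>
            ((KarpClique.annot 0 φ)[p].1 = (KarpClique.annot 0 φ)[q].1 ∧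
                (KarpClique.annot 0 φ)[p].2.1 ≠ (KarpClique.annot 0 φ)[q].2.1) ∨
            ((KarpClique.annot 0 φ)[p].2.1 = (KarpClique.annot 0 φ)[q].2.1 ∧
                (KarpClique.annot 0 φ)[p].2.2 ≠ (KarpClique.annot 0 φ)[q].2.2)⟩ →
        x.length = len φ.length ∧
        (φ.Satisfiable → 8 * τ φ.length ≤ hardcoreCount Δ p q x) ∧
        (φ.maxSatFraction ≤ 1 - γ → 0 < hardcoreCount Δ p q x ∧ hardcoreCount Δ p q x ≤ τ φ.length)

/-- THE `Nodup` HALF OF `IsExactWidth 3` IS LOAD-BEARING FOR THE COUNTING WINDOW (target S4b).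
With repeated variables allowed inside a clause, `α(conflict graph) = m · val(φ)` fails: equal
literals of one clause are pairwise compatible. Witness at `B = 2`, `γ = 1/2`, `m = 2`:
`φno = (x ∨ x ∨ x) ∧ (¬x ∨ ¬x ∨ ¬x)` has `val = 1/2` but conflict graph `K₃,₃` with
`N ≥ q⁶ + 6pq⁵ + 2p²q⁴`, while the satisfiable `φyes = (x₀ ∨ x₁ ∨ x₂) ∧ (x₃ ∨ x₄ ∨ x₅)` has
conflict graph `2K₃` with `N ≤ q⁶ + 6pq⁵ + 15p²q⁴ < 8 (q⁶ + 6pq⁵ + 2p²q⁴)`; so no threshold `τ 2`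
separates `8 τ 2 ≤ N(yes)` from `N(no) ≤ τ 2`, whatever `(Δ, p, q)` with `q ≥ 1`. (The E3
rendering feeding S4b must therefore keep three DISTINCT variables per clause — which the tree's
`GapMachine.spec` / `gapE3SAT` do guarantee via `IsExactWidth`.) [this work] -/
theorem not_conflictGraphGapWithoutNodup : ¬ ConflictGraphGapWithoutNodup := by
  intro h
  obtain ⟨Δ, p, q, τ, len, hΔ, hq, -, -, hall⟩ := h 2 (1 / 2) (by norm_num)
  have hoccY : ∀ v : ℕ, (φyes.countP fun cl => v ∈ cl.map Prod.fst) ≤ 2 := fun v =>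
    List.countP_le_length.trans (le_of_eq rfl)
  have hoccN : ∀ v : ℕ, (φno.countP fun cl => v ∈ cl.map Prod.fst) ≤ 2 := fun v =>
    List.countP_le_length.trans (le_of_eq rfl)
  have hY : 8 * τ 2 ≤ hardcoreCount Δ p q
      (encodingGraph.encode ⟨(KarpClique.annot 0 φyes).length, conflictGraph φyes⟩) :=
    (hall φyes φyes_width hoccY (by decide) _ rfl).2.1 φyes_satisfiable
  have hN : hardcoreCount Δ p q
      (encodingGraph.encode ⟨(KarpClique.annot 0 φno).length, conflictGraph φno⟩) ≤ τ 2 :=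
    ((hall φno φno_width hoccN (by decide) _ rfl).2.2 (maxSatFraction_φno_le.trans (by norm_num))).2
  have hup := hardcoreCount_φyes_le Δ p q hΔ
  have hlow := le_hardcoreCount_φno Δ p q hΔ
  have hq6 : 0 < q ^ 6 := pow_pos hq 6
  omega

/-! ## The target `stub_dupPad` with `B` in place of `max B 1` is FALSE -/

/-- Stub S2b of the picked line with the occurrence bound of the output stated as `B` instead of
`max B 1`. Verbatim otherwise. [this work] -/
def DupPadWithPlainBound : Prop :=
  ∀ a : ℕ, ∃ (d : List Bool → List Bool) (m : ℕ → ℕ) (κ : ℚ), d ∈ FP ∧ StrictMono m ∧ (∀ k, 0 < m k) ∧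
    0 < κ ∧ ∀ (φ : CNF ℕ) (y : List Bool), φ.IsExactWidth 3 → φ.length ≤ (y.length + 2) ^ a →
      ∃ ψ : CNF ℕ, d (boolPair (encodingCNF.encode φ) y) = encodingCNF.encode ψ ∧ ψ.IsExactWidth 3 ∧
        ψ.length = m y.length ∧
        (∀ B : ℕ, (∀ v : ℕ, (φ.countP fun cl => v ∈ cl.map Prod.fst) ≤ B) →
          ∀ v : ℕ, (ψ.countP fun cl => v ∈ cl.map Prod.fst) ≤ B) ∧
        (φ.Satisfiable → ψ.Satisfiable) ∧
        (∀ γ : ℚ, φ.maxSatFraction ≤ 1 - γ → ψ.maxSatFraction ≤ 1 - κ * γ)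

/-- THE `max B 1` OF TARGET S2b IS NECESSARY: with a plain `B`, the empty input CNF (occurrence
bound `B = 0`) must be padded to `m |y| > 0` clauses of exact width 3, and the first variable of
the first padding clause occurs at least once. [this work] -/
theorem not_dupPadWithPlainBound : ¬ DupPadWithPlainBound := by
  intro h
  obtain ⟨d, m, κ, -, -, hmpos, -, hall⟩ := h 0
  obtain ⟨ψ, -, hψ3, hlen, hocc, -, -⟩ := hall [] [] (fun c hc => by simp at hc) (by simp)
  have hocc0 : ∀ v : ℕ, (ψ.countP fun cl => v ∈ cl.map Prod.fst) ≤ 0 := hocc 0 fun v => by simp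
  have hpos : 0 < ψ.length := by rw [hlen]; exact hmpos _
  obtain ⟨c, hc⟩ : ∃ c, c ∈ ψ := List.exists_mem_of_length_pos hpos
  have hc3 := (hψ3 c hc).1
  obtain ⟨l, hl⟩ : ∃ l, l ∈ c := List.exists_mem_of_length_pos (by omega)
  have hcount : 0 < ψ.countP fun cl => l.1 ∈ cl.map Prod.fst :=
    List.countP_pos_iff.2 ⟨c, hc, decide_eq_true (List.mem_map_of_mem hl)⟩
  have := hocc0 l.1
  omega

/-! # Target S4b, continued: the occurrence bound is load-bearing -/

/-! ## A YES family with one variable of unbounded occurrence -/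

/-- The `j`-th negative clause `(¬x₀ ∨ x_{3j+3} ∨ x_{3j+4})`. [this work] -/
def negClause (j : ℕ) : Clause ℕ := [(0, false), (3 * j + 3, true), (3 * j + 4, true)]

/-- YES family: `(x₀ ∨ x₁ ∨ x₂)` followed by `k` clauses `(¬x₀ ∨ x_{3j+3} ∨ x_{3j+4})`, `j < k` — an
E3-CNF, satisfiable, in which `x₀` occurs `k + 1` times. [this work] -/
def ψyes (k : ℕ) : CNF ℕ := [(0, true), (1, true), (2, true)] :: (List.range k).map negClause

/-- `ψyes k` has `k + 1` clauses. [this work] -/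
theorem length_ψyes (k : ℕ) : (ψyes k).length = k + 1 := by simp [ψyes]

/-- `ψyes k` is an E3-CNF. [this work] -/
theorem isExactWidth_ψyes (k : ℕ) : (ψyes k).IsExactWidth 3 := by
  intro c hc
  simp only [ψyes, List.mem_cons, List.mem_map, List.mem_range] at hc
  rcases hc with rfl | ⟨j, -, rfl⟩
  · decide
  · refine ⟨rfl, ?_⟩
    simp [negClause]

/-- `ψyes k` is satisfiable: `x₀ := false`, everything else `true`. [this work] -/
theorem satisfiable_ψyes (k : ℕ) : (ψyes k).Satisfiable := by
  refine ⟨fun v => decide (v ≠ 0), (CNF.eval_eq_true_iff _ _).2 fun c hc => ?_⟩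
  simp only [ψyes, List.mem_cons, List.mem_map, List.mem_range] at hc
  rcases hc with rfl | ⟨j, -, rfl⟩
  · decide
  · simp [negClause, Clause.eval, Literal.eval]

/-- No clause of `ψyes k` is empty. [this work] -/
theorem ne_nil_of_mem_ψyes (k : ℕ) : ∀ c ∈ ψyes k, c ≠ [] := by
  intro c hc
  have h := (isExactWidth_ψyes k c hc).1
  rintro rfl
  simp at h

/-- Clause `j + 1` of `ψyes k` is `negClause j`. [this work] -/
theorem getElem_ψyes_succ (k j : ℕ) (hj : j + 1 < (ψyes k).length) :
    (ψyes k)[j + 1] = negClause j := by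
  simp [ψyes]

/-- THE CONFLICT GRAPH OF `ψyes k` HAS MAXIMUM DEGREE `≥ k`: the occurrence of `x₀` in the first
clause conflicts with the `k` occurrences of `¬x₀` (for any decidability instance). [this work] -/
theorem le_maxDegree_ψyes (k : ℕ) (inst : DecidableRel (conflictGraph (ψyes k)).Adj) :
    k ≤ @SimpleGraph.maxDegree _ (conflictGraph (ψyes k)) _ inst := by
  set A := KarpClique.annot 0 (ψyes k) with hA
  have hmem := KarpClique.mem_annot_iff 0 (ψyes k) (ne_nil_of_mem_ψyes k)
  -- the positive occurrence of `x₀` in clause 1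
  obtain ⟨p₀, hp₀lt, hp₀⟩ : ∃ (p : ℕ) (h : p < A.length),
      A[p] = KarpClique.annLit (0 + 0 + 1) ((0, true) : Literal ℕ) :=
    List.mem_iff_getElem.1 ((hmem _).2 ⟨0, by simp [length_ψyes], (0, true), by simp [ψyes], rfl⟩)
  -- the `k` negative occurrences
  have hq : ∀ j : Fin k, ∃ (q : ℕ) (h : q < A.length),
      A[q] = KarpClique.annLit (0 + (j.val + 1) + 1) ((0, false) : Literal ℕ) := by
    intro j
    refine List.mem_iff_getElem.1 ((hmem _).2 ⟨j.val + 1, by simp [length_ψyes], (0, false), ?_, rfl⟩)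
    rw [getElem_ψyes_succ k j.val (by simp [length_ψyes])]
    simp [negClause]
  choose q hqlt hqA using hq
  let Q : Fin k → Fin A.length := fun j => ⟨q j, hqlt j⟩
  have hQinj : Function.Injective Q := by
    intro j j' hjj'
    have e : q j = q j' := congrArg Fin.val hjj'
    have e2 := congrArg (fun p : ℕ => (A[p]?.map Prod.fst)) e
    simp only [List.getElem?_eq_getElem (hqlt j), List.getElem?_eq_getElem (hqlt j'), hqA,
      KarpClique.annLit, Option.map_some] at e2
    exact Fin.ext (by simpa using e2)
  let P : Fin A.length := ⟨p₀, hp₀lt⟩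
  have hadj : ∀ j : Fin k, (conflictGraph (ψyes k)).Adj P (Q j) := by
    intro j
    rw [SimpleGraph.fromRel_adj]
    have hP : A[P] = (1, Computability.encodeNat 0, true) := hp₀
    have hQ : A[Q j] = (j.val + 2, Computability.encodeNat 0, false) := by
      simpa [KarpClique.annLit] using hqA j
    refine ⟨fun h => ?_, Or.inl (Or.inr ?_)⟩
    · have := congrArg (fun p : Fin A.length => (A[p]).1) h
      simp only [hP, hQ] at this
      omega
    · simp only [Fin.getElem_fin]
      rw [show A[(P : ℕ)] = A[P] from rfl, show A[(Q j : ℕ)] = A[Q j] from rfl, hP, hQ]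
      simp
  calc k = (univ.image Q).card := by
        rw [card_image_of_injective _ hQinj, card_univ, Fintype.card_fin]
    _ ≤ ((conflictGraph (ψyes k)).neighborFinset P).card := by
        refine card_le_card fun w hw => ?_
        obtain ⟨j, -, rfl⟩ := mem_image.1 hw
        exact (SimpleGraph.mem_neighborFinset _ _ _).2 (hadj j)
    _ = (conflictGraph (ψyes k)).degree P := SimpleGraph.card_neighborFinset_eq_degree _ _
    _ ≤ _ := SimpleGraph.degree_le_maxDegree _ _

/-- Hence the hard-core count of the code of the conflict graph of `ψyes k` VANISHES for every
`Δ < k` (the promise `maxDegree ≤ Δ` fails). [this work] -/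
theorem hardcoreCount_ψyes_eq_zero (Δ p q k : ℕ) (hk : Δ < k) :
    hardcoreCount Δ p q
      (encodingGraph.encode ⟨(KarpClique.annot 0 (ψyes k)).length, conflictGraph (ψyes k)⟩) = 0 :=
  hardcoreCount_encode_of_lt_maxDegree Δ p q _ (hk.trans_le (le_maxDegree_ψyes k _))

/-! ## A NO family of any length `8r` -/

/-- All eight sign patterns on the variables `3i, 3i+1, 3i+2`. [this work] -/
def blockNo (i : ℕ) : CNF ℕ :=
  [[(3 * i, false), (3 * i + 1, false), (3 * i + 2, false)],
   [(3 * i, false), (3 * i + 1, false), (3 * i + 2, true)],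
   [(3 * i, false), (3 * i + 1, true), (3 * i + 2, false)],
   [(3 * i, false), (3 * i + 1, true), (3 * i + 2, true)],
   [(3 * i, true), (3 * i + 1, false), (3 * i + 2, false)],
   [(3 * i, true), (3 * i + 1, false), (3 * i + 2, true)],
   [(3 * i, true), (3 * i + 1, true), (3 * i + 2, false)],
   [(3 * i, true), (3 * i + 1, true), (3 * i + 2, true)]]

/-- NO family: `r` variable-disjoint blocks. [this work] -/
def ψno : ℕ → CNF ℕ
  | 0 => []
  | r + 1 => blockNo r ++ ψno r

/-- `ψno r` has `8r` clauses. [this work] -/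
theorem length_ψno : ∀ r : ℕ, (ψno r).length = 8 * r
  | 0 => rfl
  | r + 1 => by
    rw [ψno, List.length_append, length_ψno r]
    simp [blockNo]
    omega

/-- Every block is an E3-CNF. [this work] -/
theorem isExactWidth_blockNo (i : ℕ) : (blockNo i).IsExactWidth 3 := by
  intro c hc
  simp only [blockNo, List.mem_cons, List.not_mem_nil, or_false] at hc
  rcases hc with rfl | rfl | rfl | rfl | rfl | rfl | rfl | rfl <;>
    exact ⟨rfl, by simp⟩

/-- `ψno r` is an E3-CNF. [this work] -/
theorem isExactWidth_ψno : ∀ r : ℕ, (ψno r).IsExactWidth 3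
  | 0 => fun c hc => by simp [ψno] at hc
  | r + 1 => fun c hc => by
    rw [ψno, List.mem_append] at hc
    rcases hc with hc | hc
    · exact isExactWidth_blockNo r c hc
    · exact isExactWidth_ψno r c hc

/-- Every assignment satisfies exactly `7` clauses of a block. [this work] -/
theorem countP_blockNo (i : ℕ) (σ : ℕ → Bool) :
    ((blockNo i).countP fun c => Clause.eval σ c) = 7 := by
  cases h0 : σ (3 * i) <;> cases h1 : σ (3 * i + 1) <;> cases h2 : σ (3 * i + 2) <;>
    simp [blockNo, Clause.eval, Literal.eval, h0, h1, h2]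

/-- Every assignment satisfies exactly `7r` clauses of `ψno r`. [this work] -/
theorem countP_ψno (σ : ℕ → Bool) : ∀ r : ℕ, ((ψno r).countP fun c => Clause.eval σ c) = 7 * r
  | 0 => rfl
  | r + 1 => by
    rw [ψno, List.countP_append, countP_blockNo, countP_ψno σ r]
    ring

/-- `val(ψno r) ≤ 7/8` for `r ≥ 1`. [this work] -/
theorem maxSatFraction_ψno_le (r : ℕ) (hr : 0 < r) : (ψno r).maxSatFraction ≤ 7 / 8 := by
  classical
  unfold CNF.maxSatFraction
  refine Finset.sup'_le _ _ fun τ _ => ?_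
  generalize (fun x => if h : x ∈ CNF.vars (ψno r) then τ ⟨x, h⟩ else false) = σ
  unfold CNF.satisfiedFraction CNF.numClauses
  rw [if_neg (by rw [length_ψno]; omega), countP_ψno, length_ψno]
  have hr0 : (r : ℚ) ≠ 0 := by exact_mod_cast hr.ne'
  push_cast
  rw [mul_div_mul_right _ _ hr0]

/-! ## Target S4b without the occurrence bound is FALSE -/

/-- Stub S4b of the picked line with the occurrence hypothesis
`∀ v, (φ.countP fun cl => v ∈ cl.map Prod.fst) ≤ B` (and its now idle binder `B`) DROPPED.
Verbatim otherwise. [this work] -/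
def ConflictGraphGapWithoutOccurrenceBound : Prop :=
  ∀ γ : ℚ, 0 < γ →
    ∃ (Δ p q : ℕ) (τ len : ℕ → ℕ), 3 ≤ Δ ∧ 0 < q ∧ hardCoreThreshold Δ < (p : ℝ) / q ∧ StrictMono len ∧
      ∀ φ : CNF ℕ, φ.IsExactWidth 3 → 0 < φ.length → ∀ x : List Bool,
        x = encodingGraph.encode ⟨(KarpClique.annot 0 φ).length,
          SimpleGraph.fromRel fun p q : Fin (KarpClique.annot 0 φ).length =>
            ((KarpClique.annot 0 φ)[p].1 = (KarpClique.annot 0 φ)[q].1 ∧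
                (KarpClique.annot 0 φ)[p].2.1 ≠ (KarpClique.annot 0 φ)[q].2.1) ∨
            ((KarpClique.annot 0 φ)[p].2.1 = (KarpClique.annot 0 φ)[q].2.1 ∧
                (KarpClique.annot 0 φ)[p].2.2 ≠ (KarpClique.annot 0 φ)[q].2.2)⟩ →
        x.length = len φ.length ∧
        (φ.Satisfiable → 8 * τ φ.length ≤ hardcoreCount Δ p q x) ∧
        (φ.maxSatFraction ≤ 1 - γ → 0 < hardcoreCount Δ p q x ∧ hardcoreCount Δ p q x ≤ τ φ.length)

/-- THE OCCURRENCE BOUND OF TARGET S4b IS LOAD-BEARING. Without it, at `γ = 1/8` and whatever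
`(Δ, p, q, τ)`: the satisfiable E3-CNF `ψyes (8Δ - 1)` (in which `x₀` occurs `8Δ` times) has a
conflict graph of maximum degree `≥ 8Δ - 1 > Δ`, so its code is OFF the promise and `N = 0`,
forcing `τ (8Δ) = 0`; but `ψno Δ` (`Δ` disjoint copies of the complete sign pattern, `8Δ` clauses,
`val ≤ 7/8`) must then have `0 < N ≤ τ (8Δ) = 0`. (In the line the bound is supplied by S2a and
preserved by S2b.) [this work] -/
theorem not_conflictGraphGapWithoutOccurrenceBound : ¬ ConflictGraphGapWithoutOccurrenceBound := by
  intro h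
  obtain ⟨Δ, p, q, τ, len, hΔ, -, -, -, hall⟩ := h (1 / 8) (by norm_num)
  -- YES side: `ψyes (8Δ - 1)`, length `8Δ`, count `0`
  have hY := (hall (ψyes (8 * Δ - 1)) (isExactWidth_ψyes _) (by rw [length_ψyes]; omega) _ rfl).2.1
    (satisfiable_ψyes _)
  rw [hardcoreCount_ψyes_eq_zero Δ p q (8 * Δ - 1) (by omega), length_ψyes,
    show 8 * Δ - 1 + 1 = 8 * Δ by omega] at hY
  -- NO side: `ψno Δ`, length `8Δ`
  have hN := (hall (ψno Δ) (isExactWidth_ψno Δ) (by rw [length_ψno]; omega) _ rfl).2.2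
    ((maxSatFraction_ψno_le Δ (by omega)).trans (by norm_num))
  rw [length_ψno] at hN
  omega

/-! ## Two harmless corners of the targets -/

/-- S2b's value clause at the empty input CNF is VACUOUS thanks to the tree's junk convention
`val([]) = 1` (`CNF.maxSatFraction_nil`): the hypothesis `val [] ≤ 1 - γ` holds iff `γ ≤ 0`, and
then the conclusion `val ψ ≤ 1 - κγ` is automatic. (With the other common convention `val([]) = 0`
the stub `stub_dupPad` would be false: `[]` is satisfiable, so `ψ` would have to be satisfiable AND
of value `≤ 1 - κ`.) [this work] -/
theorem maxSatFraction_nil_le_iff (γ : ℚ) : CNF.maxSatFraction ([] : CNF ℕ) ≤ 1 - γ ↔ γ ≤ 0 := by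
  rw [CNF.maxSatFraction_nil]
  constructor <;> intro h <;> linarith

/-- S4b's hypothesis `0 < φ.length` is NOT load-bearing: the conflict graph of `[]` is the empty
graph on `Fin 0`, whose code has hard-core count `1` (the empty independent set), so at `m = 0` the
YES clause only forces `τ 0 = 0` and the NO clause is vacuous (`val [] = 1`). [this work] -/
theorem hardcoreCount_conflictGraph_nil (Δ p q : ℕ) :
    hardcoreCount Δ p q
      (encodingGraph.encode ⟨(KarpClique.annot 0 ([] : CNF ℕ)).length, conflictGraph []⟩) = 1 := by
  have h0 : (KarpClique.annot 0 ([] : CNF ℕ)).length = 0 := rfl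
  have hdeg : ∀ inst : DecidableRel (conflictGraph ([] : CNF ℕ)).Adj,
      @SimpleGraph.maxDegree _ (conflictGraph []) _ inst ≤ Δ := fun inst =>
    (@SimpleGraph.maxDegree_le_of_forall_degree_le _ (conflictGraph []) _ inst 0
      fun v => (Fin.cast h0 v).elim0).trans (Nat.zero_le _)
  rw [hardcoreCount_encode_of_maxDegree_le Δ p q _ (hdeg _)]
  have huniv : (univ : Finset (Finset (Fin (KarpClique.annot 0 ([] : CNF ℕ)).length))) = {∅} := by
    apply Finset.eq_singleton_iff_unique_mem.2
    refine ⟨mem_univ _, fun I _ => Finset.eq_empty_of_forall_notMem fun v _ => ?_⟩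
    exact (Fin.cast h0 v).elim0
  rw [huniv, Finset.sum_singleton, if_pos (by simp [SimpleGraph.isIndepSet_iff])]
  simp [h0]

end Targets

end Summit.PneNP.PneNP.Cruxes.PseudorandomTwinsAbove.Disproof
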